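import Literature.NumberTheory.Rogawski1990.RankOneTorusStablePartner                       -- ★ p843436 F0P2-p01 (g10): `formCongr_diagonal_antidiagTwo`, `partnerCongr_frame`, `isLocalStablyConjH_partnerCongr_not_isConj` (generic in the σ-fixed non-norm ring-unit `r`); brings ★ p843033 (G4) frames
import Literature.NumberTheory.Automorphic.Liu2021.LemD1AsPrintedIndexedNonVacuityRamifiedPlace  -- ★ `exists_unit_not_isNorm_of_ramified` (a unit of `F_v` which is NOT a norm at a RAMIFIED non-split place — tame and wild)
import Literature.NumberTheory.Automorphic.LocalUnitaryGroupSimilitudeLevel                    -- ★ `localFormCongr_mem_localIntegralLevel_iff` (componentwise-integral similitudes match the integral levels)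
import Literature.NumberTheory.Automorphic.LocalUnitaryGroupCongrMeasure                       -- ★ `measurePreserving_of_map_apply_eq` (a Haar measure is pinned by ONE set); topological instances on the `cmDatum` carriers
import Literature.NumberTheory.Automorphic.UnitaryResiduallyRegularOrbitalIntegral             -- ★ `isCompact_isOpen_cmLocalIntegralLevel_prod` (`K_H = U(Φ₂)(𝒪_v) ×ˢ U(Φ₁)(𝒪_v)` compact open)
import Literature.NumberTheory.Automorphic.LocalGLCongruenceBoxIwahori                         -- ★ `localGLPiEquiv_apply_apply` (`(g_w)_{ij} = (g_{ij})_w`)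
import Literature.NumberTheory.Automorphic.ValuedFieldValuativeRelBridge                       -- ★ `mem_glInt_iff_forall_v_le_one`
import HarnessLib

/-!
# (R1-ram, R-0 + R-1) THE RAMIFIED UNIT SIMILITUDE: at a ramified non-split place the stable partner `Ad diag(1, u)` has an INTEGRAL unit multiplier, preserves the
# level `K_H` and every Haar measure, and the κ-orbital difference VANISHES on every `Ad diag(1,u)`-invariant test function — in particular on the unit `𝟙_{K_H}`
# (road «R1-ram» of record = F0P3-p02 (g12) MEMO-R1ram §4, bricks R-0 + R-1; Labesse–Langlands 1979 §2: «φ^T(γ, f) = 0 if L is ramified»; Rogawski 1990 Lemma 4.9.3)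

Topic `NumberTheory/Rogawski1990`; namespace `Literature.NumberTheory.Rogawski1990`.  THEOREMS ONLY (no definition, no instance, no notation, no named fact, no `sorry`).
Cell `pub/hodgecm-mathlib` (D-0151), crux H413 = `stmt-HodgeConjecture-24833`, line «N6nsGerm» stub `stub_N6nsR1LL : RankOneUnstableTransferNonsplitCME`; its RAMIFIED residue
★ `RankOneUnstableTransferNonsplitCMERamified` (ED. 4 :319) is reduced by ★ p843417 `rankOneUnstableTransferNonsplitCMERamified_of_core` (F0P3a-p08 (g14), R-5a) to the ramified
core `hcore_ram`, whose assembly (R-5b) runs ★ L1 `rankOneUnstable_core_inert_of_eventually` (place-agnostic) on the sockets `τ ∕ hτst ∕ hEv`.  LEAD F0P3a-plan (g10) WORD T9-12 (2);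
architect A-p16 (g27) RULINGS A-14 (c) (ramified road of record), A-16, A-17; census F0P3-p02 (g12) `CENSUS-R1ram-R0R1-UnitSimilitude` 29c01a21 + delta A-p19 (g23) 9d4a4091.
HONEST LABEL: HC_CM is proved only modulo the printed citations (the 2 remaining named inputs hLiu418, h413) until rung 0 closes; this file is unconditional local algebra ∕
measure theory — nothing printed is asserted.

THE MATHEMATICS.  `L` CM, `v` a finite place of `L⁺` with ONE place `w` of `L` above it, RAMIFIED (`e(w|v) ≠ 1`); `H_v = U(Φ₂)(L⁺_v) × U(Φ₁)(L⁺_v)`, `K_H = U(Φ₂)(𝒪_v) ×ˢ U(Φ₁)(𝒪_v)`.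
[LabesseLanglands1979, §2 pp. 8–10]: the second class of the stable class of a regular `t` in the elliptic torus is `Ad_h t` for the SIMILITUDE `h = diag(1, u)` of `Φ₂ = antidiag(1,1)`
whose multiplier `u ∈ 𝒪_{F_v}ˣ` is a UNIT which is NOT a norm from `E_w` — such a unit exists iff `w ∣ v` is ramified (★ `exists_unit_not_isNorm_of_ramified`; at an inert place every
unit is a norm).  Since `h ∈ GL₂(𝒪_w)`, `Ad_h` normalises `K_H`, hence preserves every Haar measure of `H_v`, and `O(t′, f) = O(Ad_h t, f) = O(t, f ∘ Ad_h)`: the κ-difference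
`O(t, f) − O(t′, f) = O(t, f − f ∘ Ad_h)` VANISHES for `Ad_h`-invariant `f`, in particular for the unit `𝟙_{K_H}` — «it is clear that `φ^T(γ, f) = 0` if `L` is ramified» [LL p. 9].
Contrast the inert unit row ★ `RankOneUnstableUnitCertificate` (an alternating vertex count, never `0`).

WHAT IS PROVED (binder shapes of ★ L1 `rankOneUnstable_core_inert_of_eventually` ∕ ★ p843033's `hcore`: frames `(t₀ P d ht₀ hP hd1)`, torus `Z(t₀)`, `Δ`-tokens verbatim; the partner in
F0P2-p01's LocalRing currency `T_r = glDiagonal 2 (LocalRing L v) ![1, r]` via ★ `cmDatumLocalCongr`):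
* §1 (any locally compact group) `measurePreserving_self_of_forall_mem_iff` (an automorphism mapping ONE compact open `K ∋ 1` onto itself preserves every Haar measure),
  `integral_conj_map_eq_integral_comp_conj` (`∫ f(y·e(x)·y⁻¹) dμ = ∫ (f ∘ e)(y·x·y⁻¹) dμ` for `μ`-preserving `e`).
* §2 `exists_integralUnit_conjLocal_eq_not_exists_norm_of_ramified` (a `σ`-fixed ring-unit `r`, integral at every `w'`, NOT of the form `σ(z) z`), and the bridge
  `exists_placesOver_ramificationIdx'_ne_one_of_not_isUnramifiedIn` ∕ `ramificationIdx'_ne_one_of_not_isUnramifiedIn` from the letter's `hram` to `e(w|v) ≠ 1`.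
* §3 `localGLPiEquiv_glDiagonal_one_mem_glInt`, `cmDatumLocalCongr_glDiagonal_mem_cmLocalIntegralLevel_iff` (`Ad T_r` matches `U(Φ₂)(𝒪_v)`).
* §4 THE PACKAGE **`exists_unitSimilitudePartner_of_ramified`** (`(w hw he)` binders) ∕ **`exists_stablePartner_congr_of_ramified`** (`(hv hram)` binders): `∃ r hru (e : H_v ≃ₜ* H_v)`,
  `e = (Ad T_r, id)` on the nose, F0P2-p01's `hτP` frame, the socket `hτst`, LEVEL `e K_H = K_H`, HAAR `MeasurePreserving e ν ν` for every Haar `ν`.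
* §5 R-1: `isConj_of_stablePartner_of_not_isConj` (two classes), **`integral_conj_eq_integral_comp_of_stablePartner`** (`O_ν(t′, f) = O_ν(t, f ∘ e)`),
  **`rankOneDelta_mul_sub_integral_eq_zero_of_comp_eq`** (`f ∘ e = f ⇒ Δ(t)·(O_ν(t,f) − O_ν(t′,f)) = 0`), the DISCHARGED unit row
  **`rankOneDelta_mul_sub_integral_indicator_eq_zero_of_ramified`** (`f = 𝟙_{K_H}`) and its `∃ fC` (`= 0`) dress `exists_core_indicator_of_ramified`.

## References
* [LabesseLanglands1979] J.-P. Labesse, R. P. Langlands, *L-indistinguishability for SL(2)*, Canad. J. Math. 31 (1979): §2, Lemma 2.1 and pp. 8–10 (ramified `δ_m = 2q^m`;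
  «φ^T(γ, f) = 0 if L is ramified», p. 9).
* [Rogawski1990] J. D. Rogawski, *Automorphic Representations of Unitary Groups in Three Variables*, Ann. of Math. Stud. 123 (1990): §3.5 Prop. 3.5.2 (c) p. 29, §3.6 pp. 31–32,
  §4.9 Lemma 4.9.3 (4.9.2) p. 56.
* [PlatonovRapinchuk1994] V. Platonov, A. Rapinchuk, *Algebraic Groups and Number Theory* (1994): §2.3, §3.5, §5.1; [Folland1995] G. B. Folland, *Abstract Harmonic Analysis* (1995): Thm. 2.20.
* [NeukirchANT1999] J. Neukirch, *Algebraic Number Theory* (1999): Ch. I §8 Prop. (8.2) (`Σ eᵢ fᵢ = n`).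
-/

set_option autoImplicit false

noncomputable section

open Set Filter Topology MeasureTheory NumberField IsDedekindDomain Polynomial Matrix
open scoped MatrixGroups

namespace Literature.NumberTheory.Rogawski1990

open Literature.NumberTheory.Automorphic Literature.NumberTheory.Automorphic.UnitaryGroup Literature.NumberTheory.GaloisRepresentations

/-! ## §1 Two generic facts on a locally compact group: Haar preservation from ONE invariant compact open set; conjugation integrals along an automorphism -/

section Haar

variable {G : Type*} [Group G] [TopologicalSpace G] [IsTopologicalGroup G] [LocallyCompactSpace G] [SecondCountableTopology G]
  [MeasurableSpace G] [BorelSpace G]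

/-- **An automorphism that maps ONE compact open neighbourhood of `1` onto itself preserves every Haar measure.**  For `e : G ≃ₜ* G` and a compact open `K ∋ 1` with
`e g ∈ K ↔ g ∈ K`: `e_* μ` is a Haar measure (Mathlib), it agrees with `μ` on `K` (`(e_* μ)(K) = μ(e⁻¹ K) = μ(K) ∈ (0, ∞)`), hence `e_* μ = μ` (★ `measurePreserving_of_map_apply_eq`,
uniqueness of Haar measure).  On `U(1,1)`: `Ad diag(1,u)`, `u` a unit, normalises `K = U ∩ GL₂(𝒪)`. [cite: Folland1995, Thm. 2.20] [cite: PlatonovRapinchuk1994, §3.5] -/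
theorem measurePreserving_self_of_forall_mem_iff (e : G ≃ₜ* G) {K : Set G} (hKc : IsCompact K) (hKo : IsOpen K) (h1 : (1 : G) ∈ K)
    (hK : ∀ g, e g ∈ K ↔ g ∈ K) (μ : Measure G) [μ.IsHaarMeasure] : MeasurePreserving e μ μ := by
  have hpre : e ⁻¹' K = K := Set.ext fun g => hK g
  exact measurePreserving_of_map_apply_eq e μ μ (hKo.measure_pos μ ⟨1, h1⟩).ne' hKc.measure_lt_top.ne (by rw [hpre])

omit [IsTopologicalGroup G] [LocallyCompactSpace G] [SecondCountableTopology G] in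
/-- **Conjugation integrals along a measure-preserving automorphism**: if `e : G ≃ₜ* G` preserves `μ` then for every `f` and `x`,
`∫ f(y · e(x) · y⁻¹) dμ(y) = ∫ (f ∘ e)(y · x · y⁻¹) dμ(y)` (substitute `y = e(y′)`: `e(y′)·e(x)·e(y′)⁻¹ = e(y′ x y′⁻¹)`).  The orbital integral at the PARTNER `e(x)` is the orbital
integral at `x` of the pulled-back test function. [cite: LabesseLanglands1979, §2 p. 9] [cite: Folland1995, Thm. 2.20] -/
theorem integral_conj_map_eq_integral_comp_conj (μ : Measure G) (e : G ≃ₜ* G) (he : MeasurePreserving e μ μ) (f : G → ℂ) (x : G) :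
    ∫ y, f (y * e x * y⁻¹) ∂μ = ∫ y, (f ∘ e) (y * x * y⁻¹) ∂μ := by
  have hemb : MeasurableEmbedding e := e.toHomeomorph.measurableEmbedding
  rw [← he.integral_comp hemb (fun y : G => f (y * e x * y⁻¹))]
  refine integral_congr_ae (Filter.Eventually.of_forall fun y => ?_)
  simp only [Function.comp_apply, map_mul, map_inv]

omit [TopologicalSpace G] [IsTopologicalGroup G] [LocallyCompactSpace G] [SecondCountableTopology G] [BorelSpace G] in
/-- The plain orbital integral for a right-invariant `μ` is a CLASS FUNCTION: `∫ f(y t′ y⁻¹) dμ = ∫ f(y t y⁻¹) dμ` for `t′ = c t c⁻¹` (`y ↦ y c`).  (Local copy of ★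
`integral_conj_eq_of_isConj`.) [cite: Rogawski1990, §4.3 (4.3.1) p. 43] -/
private theorem integral_conj_eq_of_isConj₁₁ [MeasurableMul G] (μ : Measure G) [μ.IsMulRightInvariant] (f : G → ℂ) {t t' : G} (h : IsConj t t') :
    ∫ y, f (y * t' * y⁻¹) ∂μ = ∫ y, f (y * t * y⁻¹) ∂μ := by
  obtain ⟨c, hc⟩ := isConj_iff.1 h
  rw [← hc]
  have key : (fun y : G => f (y * (c * t * c⁻¹) * y⁻¹)) = fun y => (fun z : G => f (z * t * z⁻¹)) (y * c) := by
    funext y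
    simp only [_root_.mul_inv_rev, mul_assoc]
  rw [key, integral_mul_right_eq_self (fun z : G => f (z * t * z⁻¹)) c]

end Haar

/-! ## §2 At a RAMIFIED non-split place: a `σ`-fixed INTEGRAL unit of `L ⊗ L⁺_v` which is not a norm -/

section IntegralUnit

variable (L : Type) [Field L] [NumberField L] [IsCMField L] (v : HeightOneSpectrum (𝓞 ↥(maximalRealSubfield L)))

/-- **A `σ`-FIXED INTEGRAL UNIT WHICH IS NOT A NORM, at a RAMIFIED non-split place.**  For `w ∣ v` with `w̄ = w` and `e(w|v) ≠ 1` there is `r ∈ L ⊗ L⁺_v` with `σ r = r`,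
`r` a ring-unit, `v_{w'}(r_{w'}) = 0` at every `w' ∣ v` (so `diag(1, r) ∈ GL₂(𝒪)` componentwise), and `r ≠ σ(z) z` for every unit `z` — namely `r = ι_v(u)` for the unit
`u ∈ 𝒪_{L⁺_v}ˣ ∖ N(L_wˣ)` of ★ `exists_unit_not_isNorm_of_ramified` (at a ramified place the local norm index `2` is carried by the units; at an inert place every unit is a
norm and no such `r` exists).  Uniform in the residue characteristic. [cite: LabesseLanglands1979, §2 p. 9] [cite: CasselsFrohlichANT1967, Ch. VI §1.1] [cite: Omeara1963, §63B Cor. 63:13a] -/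
theorem exists_integralUnit_conjLocal_eq_not_exists_norm_of_ramified (w : PlacesOver L v) (hw : IsCMField.complexConj L • w.1 = w.1)
    (he : v.asIdeal.ramificationIdx' w.1.asIdeal ≠ 1) :
    ∃ r : LocalRing L v, conjLocal L (IsCMField.complexConj L) v r = r ∧ IsUnit r ∧ (∀ w' : PlacesOver L v, Valued.v (r w') = 1) ∧
      ¬ ∃ z : LocalRing L v, IsUnit z ∧ r = conjLocal L (IsCMField.complexConj L) v z * z := by
  obtain ⟨αg, hα0, hcα, -⟩ := cmQuadraticGenerator_spec L
  obtain ⟨u, hvu, hu⟩ := Liu2021.LemD1IndexedNonVacuityRamifiedPlace.exists_unit_not_isNorm_of_ramified L v (IsCMField.complexConj L) hcα hα0 w hw he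
  refine ⟨toLocalRing L v (u : v.adicCompletion ↥(maximalRealSubfield L)), conjLocal_toLocalRing (IsCMField.complexConj L) v _, u.isUnit.map _,
    fun w' => ?_, ?_⟩
  · rw [toLocalRing_apply, valued_toPlace, hvu, one_pow]
  · rintro ⟨z, hz, hzr⟩
    refine hu ⟨hz.unit, ?_⟩
    rw [IsUnit.unit_spec, algebraMap_localRing_eq, mul_comm, ← hzr]

omit [IsCMField L] in
/-- **`¬ IsUnramifiedIn ⇒` some place `w ∣ v` of `L` has `e(w|v) ≠ 1`** (Mathlib `Algebra.isUnramifiedIn_iff_forall_ramificationIdx_eq_one`; the tree's `ramificationIdx'` of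
★ `valued_toPlace` is Mathlib's `ramificationIdx`, `Ideal.ramificationIdx'_eq_ramificationIdx`).  The bridge from the letter's binder `hram` (★ p843417 `hcore_ram`) to the
`he` binder of ★ B-p10 R-4 ∕ ★ p843426 (r0) ∕ this file. [cite: NeukirchANT1999, Ch. I §8 Prop. (8.2)] -/
theorem exists_placesOver_ramificationIdx'_ne_one_of_not_isUnramifiedIn (hram : ¬ Algebra.IsUnramifiedIn (𝓞 L) v.asIdeal) :
    ∃ w : PlacesOver L v, v.asIdeal.ramificationIdx' w.1.asIdeal ≠ 1 := by
  classical
  rw [Algebra.isUnramifiedIn_iff_forall_ramificationIdx_eq_one] at hram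
  push Not at hram
  obtain ⟨Q, hQ, hQv, hne⟩ := hram
  have hQ0 : Q ≠ ⊥ := Ideal.ne_bot_of_liesOver_of_ne_bot v.ne_bot Q
  refine ⟨⟨⟨Q, hQ, hQ0⟩, HeightOneSpectrum.ext hQv.over.symm⟩, ?_⟩
  rw [Ideal.ramificationIdx'_eq_ramificationIdx v.asIdeal Q v.ne_bot]
  exact hne

omit [IsCMField L] in
/-- **… with ONE place above `v`, that place is ramified**: `hv : Subsingleton (PlacesOver L v)`, `hram : ¬ IsUnramifiedIn` ⇒ `e(w|v) ≠ 1` for the given `w`.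
[cite: NeukirchANT1999, Ch. I §8 Prop. (8.2)] -/
theorem ramificationIdx'_ne_one_of_not_isUnramifiedIn (hv : Subsingleton (PlacesOver L v)) (hram : ¬ Algebra.IsUnramifiedIn (𝓞 L) v.asIdeal)
    (w : PlacesOver L v) : v.asIdeal.ramificationIdx' w.1.asIdeal ≠ 1 := by
  obtain ⟨w', hw'⟩ := exists_placesOver_ramificationIdx'_ne_one_of_not_isUnramifiedIn L v hram
  rwa [Subsingleton.elim w w']

/-- At a place with ONE prime of `L` above it, that prime is fixed by complex conjugation (local copy of ★ `smul_eq_of_subsingleton_placesOver`).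
[cite: CasselsFrohlichANT1967, Ch. VII Prop. 1.2 (ii)] -/
private theorem smul_eq_of_subsingleton_placesOver₁₄ (hv : Subsingleton (PlacesOver L v)) (w : PlacesOver L v) :
    IsCMField.complexConj L • w.1 = w.1 := by
  have hmem : (IsCMField.complexConj L • w.1).under (𝓞 ↥(maximalRealSubfield L)) = v := by
    rw [HeightOneSpectrum.under_algEquiv_smul]; exact w.2
  exact congrArg Subtype.val (Subsingleton.elim (⟨IsCMField.complexConj L • w.1, hmem⟩ : PlacesOver L v) w)

end IntegralUnit

/-! ## §3 `T_r = diag(1, r)` is componentwise integral for an integral unit `r`; `Ad T_r` matches the level `U(Φ₂)(𝒪_v)` -/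

section Level

variable (L : Type) [Field L] [NumberField L] [IsCMField L] (v : HeightOneSpectrum (𝓞 ↥(maximalRealSubfield L)))

omit [IsCMField L] in
/-- **`diag(1, r)_w ∈ GL₂(𝒪_w)`** at every `w ∣ v`, for a ring-unit `r ∈ L ⊗ L⁺_v` with `v_w(r_w) = 0` everywhere (entries `1, r_w` and `1, r_w⁻¹` have valuation `≤ 1`;
★ `mem_glInt_iff_forall_v_le_one`, ★ `localGLPiEquiv_apply_apply`). [cite: PlatonovRapinchuk1994, §5.1] -/
theorem localGLPiEquiv_glDiagonal_one_mem_glInt {r : LocalRing L v} (hru : IsUnit r) (hrv : ∀ w' : PlacesOver L v, Valued.v (r w') = 1)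
    (w' : PlacesOver L v) :
    localGLPiEquiv L 2 v (glDiagonal 2 (LocalRing L v) ![1, hru.unit]) w' ∈ glInt 2 (w'.1.adicCompletion L) := by
  have hd : ∀ i : Fin 2, Valued.v (((![(1 : (LocalRing L v)ˣ), hru.unit] i : (LocalRing L v)ˣ) : LocalRing L v) w') = 1 := by
    intro i
    fin_cases i
    · simp
    · simpa [IsUnit.unit_spec] using hrv w'
  have hdi : ∀ i : Fin 2, Valued.v ((((![(1 : (LocalRing L v)ˣ), hru.unit] i)⁻¹ : (LocalRing L v)ˣ) : LocalRing L v) w') = 1 := fun i => by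
    have h : Valued.v (((![(1 : (LocalRing L v)ˣ), hru.unit] i : (LocalRing L v)ˣ) : LocalRing L v) w') *
        Valued.v ((((![(1 : (LocalRing L v)ˣ), hru.unit] i)⁻¹ : (LocalRing L v)ˣ) : LocalRing L v) w') = 1 := by
      rw [← map_mul, ← Pi.mul_apply, Units.mul_inv, Pi.one_apply, map_one]
    rwa [hd i, one_mul] at h
  refine (Literature.NumberTheory.Automorphic.mem_glInt_iff_forall_v_le_one _).2 ⟨fun i j => ?_, fun i j => ?_⟩
  · rw [localGLPiEquiv_apply_apply, coe_glDiagonal, Matrix.diagonal_apply]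
    split_ifs with h
    · exact (hd i).le
    · rw [Pi.zero_apply, map_zero]; exact zero_le
  · rw [← Pi.inv_apply, ← map_inv, localGLPiEquiv_apply_apply, ← map_inv, coe_glDiagonal, Matrix.diagonal_apply]
    split_ifs with h
    · rw [Pi.inv_apply]; exact (hdi i).le
    · rw [Pi.zero_apply, map_zero]; exact zero_le

/-- **`Ad T_r` MATCHES THE LEVEL `U(Φ₂)(𝒪_v)`**: for the similitude `T_r = diag(1, r)` of `Φ₂` (★ `formCongr_diagonal_antidiagTwo`) with an INTEGRAL unit `r`,
`T_r g T_r⁻¹ ∈ U(Φ₂)(𝒪_v) ↔ g ∈ U(Φ₂)(𝒪_v)` (★ `localFormCongr_mem_localIntegralLevel_iff`). [cite: PlatonovRapinchuk1994, §5.1] [cite: LabesseLanglands1979, §2 p. 9] -/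
theorem cmDatumLocalCongr_glDiagonal_mem_cmLocalIntegralLevel_iff {r : LocalRing L v} (hru : IsUnit r)
    (hrσ : conjLocal L (IsCMField.complexConj L) v r = r) (hrv : ∀ w' : PlacesOver L v, Valued.v (r w') = 1)
    (g : (cmDatum L 2 (Matrix.of fun i j : Fin 2 => if i.val + j.val + 1 = 2 then (1 : L) else 0)).Local v) :
    (cmDatumLocalCongr L v (glDiagonal 2 (LocalRing L v) ![1, hru.unit]) hru (formCongr_diagonal_antidiagTwo L v hru hrσ)) g ∈ cmLocalIntegralLevel L 2 (Matrix.of fun i j : Fin 2 => if i.val + j.val + 1 = 2 then (1 : L) else 0) v ↔ g ∈ cmLocalIntegralLevel L 2 (Matrix.of fun i j : Fin 2 => if i.val + j.val + 1 = 2 then (1 : L) else 0) v :=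
  localFormCongr_mem_localIntegralLevel_iff (IsCMField.complexConj L) v (glDiagonal 2 (LocalRing L v) ![1, hru.unit]) hru (formCongr_diagonal_antidiagTwo L v hru hrσ)
    (localGLPiEquiv_glDiagonal_one_mem_glInt L v hru hrv) g

end Level

/-! ## §4 THE PACKAGE on `H_v = U(Φ₂)(L⁺_v) × U(Φ₁)(L⁺_v)`: the unit similitude partner `e = (Ad T_r, id)` with all its ramified virtues -/

section Package

variable (L : Type) [Field L] [NumberField L] [IsCMField L] (v : HeightOneSpectrum (𝓞 ↥(maximalRealSubfield L)))

/-- **`(Ad T_r, id)` MATCHES THE LEVEL `K_H = U(Φ₂)(𝒪_v) ×ˢ U(Φ₁)(𝒪_v)`** (first factor §3; second factor untouched). [cite: PlatonovRapinchuk1994, §5.1] -/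
theorem prodMk_cmDatumLocalCongr_mem_prod_iff {r : LocalRing L v} (hru : IsUnit r)
    (hrσ : conjLocal L (IsCMField.complexConj L) v r = r) (hrv : ∀ w' : PlacesOver L v, Valued.v (r w') = 1) (a : ((cmDatum L 2 (Matrix.of fun i j : Fin 2 => if i.val + j.val + 1 = 2 then (1 : L) else 0)).Local v × (cmDatum L 1 (Matrix.of fun i j : Fin 1 => if i.val + j.val + 1 = 1 then (1 : L) else 0)).Local v)) :
    (((cmDatumLocalCongr L v (glDiagonal 2 (LocalRing L v) ![1, hru.unit]) hru (formCongr_diagonal_antidiagTwo L v hru hrσ)) a.1, a.2) : ((cmDatum L 2 (Matrix.of fun i j : Fin 2 => if i.val + j.val + 1 = 2 then (1 : L) else 0)).Local v × (cmDatum L 1 (Matrix.of fun i j : Fin 1 => if i.val + j.val + 1 = 1 then (1 : L) else 0)).Local v)) ∈ ((cmLocalIntegralLevel L 2 (Matrix.of fun i j : Fin 2 => if i.val + j.val + 1 = 2 then (1 : L) else 0) v).prod (cmLocalIntegralLevel L 1 (Matrix.of fun i j : Fin 1 => if i.val + j.val + 1 = 1 then (1 : L) else 0) v) : Subgroup ((cmDatum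 L 2 (Matrix.of fun i j : Fin 2 => if i.val + j.val + 1 = 2 then (1 : L) else 0)).Local v × (cmDatum L 1 (Matrix.of fun i j : Fin 1 => if i.val + j.val + 1 = 1 then (1 : L) else 0)).Local v)) ↔ a ∈ ((cmLocalIntegralLevel L 2 (Matrix.of fun i j : Fin 2 => if i.val + j.val + 1 = 2 then (1 : L) else 0) v).prod (cmLocalIntegralLevel L 1 (Matrix.of fun i j : Fin 1 => if i.val + j.val + 1 = 1 then (1 : L) else 0) v) : Subgroup ((cmDatum L 2 (Matrix.of fun i j : Fin 2 => if i.val + j.val + 1 = 2 then (1 : L) else 0)).Local v × (cmDatum L 1 (Matrix.of fun i j : Fin 1 => if i.val + j.val + 1 = 1 then (1 : L) else 0)).Local v)) := by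
  rw [Subgroup.mem_prod, Subgroup.mem_prod, cmDatumLocalCongr_glDiagonal_mem_cmLocalIntegralLevel_iff L v hru hrσ hrv]

/-- **THE UNIT SIMILITUDE PARTNER AT A RAMIFIED PLACE (R-0 package; the sockets `τ ∕ hτst` of ★ L1 `rankOneUnstable_core_inert_of_eventually` PLUS level matching and Haar
preservation).**  At a RAMIFIED non-split `w ∣ v`, for `t₀ ∈ H_v = U(Φ₂)(L⁺_v) × U(Φ₁)(L⁺_v)` with `t₀.1` regular and an eigenframe `t₀.1·P = P·diag d`, `σ(dᵢ) dᵢ = 1`, there are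
a `σ`-fixed INTEGRAL unit `r ∈ L ⊗ L⁺_v` which is NOT a norm (§2) and a topological-group automorphism `e : H_v ≃ₜ* H_v` with, ON THE NOSE, `(e a).1 = T_r a.1 T_r⁻¹`
(`T_r = diag(1, r)`, F0P2-p01's similitude ★ `formCongr_diagonal_antidiagTwo`) and `(e a).2 = a.2`; such that: (frame, F0P2-p01's `hτP`) `(e t).1·(T_r P) = (T_r P)·diag(τ₀ t, τ₁ t)`
for every `t ∈ Z(t₀)` with the SAME diagonal `τᵢ t = (P⁻¹ t.1 P)ᵢᵢ`; (`hτst`) `e t` is stably conjugate and NOT conjugate to `t` for every `t ∈ Z(t₀)` with `t.1` regular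
(★ `isLocalStablyConjH_partnerCongr_not_isConj`); (LEVEL) `e a ∈ K_H ↔ a ∈ K_H`; (HAAR) `e` preserves EVERY Haar measure of `H_v` (§1 from the level clause).  This is the
similitude `h = diag(1, u₀)` of [LabesseLanglands1979 §2] ∕ MEMO-R1ram §2 in the tree's currency; the extra LEVEL∕HAAR clauses are what the ramified place buys over the
inert one (there `r` is a uniformiser and `Ad T_r` swaps the two vertex stabilisers). [cite: LabesseLanglands1979, §2 pp. 8–10] [cite: Rogawski1990, §3.5 Prop. 3.5.2 (c) p. 29; §3.6 pp. 31–32; §4.9 Lemma 4.9.3 p. 56]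
[cite: PlatonovRapinchuk1994, §2.3, §5.1] -/
theorem exists_unitSimilitudePartner_of_ramified (w : PlacesOver L v) (hw : IsCMField.complexConj L • w.1 = w.1)
    (he : v.asIdeal.ramificationIdx' w.1.asIdeal ≠ 1) [MeasurableSpace ((cmDatum L 2 (Matrix.of fun i j : Fin 2 => if i.val + j.val + 1 = 2 then (1 : L) else 0)).Local v × (cmDatum L 1 (Matrix.of fun i j : Fin 1 => if i.val + j.val + 1 = 1 then (1 : L) else 0)).Local v)] [BorelSpace ((cmDatum L 2 (Matrix.of fun i j : Fin 2 => if i.val + j.val + 1 = 2 then (1 : L) else 0)).Local v × (cmDatum L 1 (Matrix.of fun i j : Fin 1 => if i.val + j.val + 1 = 1 then (1 : L) else 0)).Local v)]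
    (t₀ : ((cmDatum L 2 (Matrix.of fun i j : Fin 2 => if i.val + j.val + 1 = 2 then (1 : L) else 0)).Local v × (cmDatum L 1 (Matrix.of fun i j : Fin 1 => if i.val + j.val + 1 = 1 then (1 : L) else 0)).Local v)) (P : GL (Fin 2) (LocalRing L v)) (d : Fin 2 → (LocalRing L v)) (ht₀ : IsRegularElt (t₀.1.val : GL (Fin 2) (LocalRing L v)))
    (hP : (t₀.1.val.val : Matrix (Fin 2) (Fin 2) (LocalRing L v)) * P.val = P.val * Matrix.diagonal d) (hd1 : ∀ i, conjLocal L (IsCMField.complexConj L) v (d i) * d i = 1) :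
    ∃ (r : LocalRing L v) (hru : IsUnit r) (e : ((cmDatum L 2 (Matrix.of fun i j : Fin 2 => if i.val + j.val + 1 = 2 then (1 : L) else 0)).Local v × (cmDatum L 1 (Matrix.of fun i j : Fin 1 => if i.val + j.val + 1 = 1 then (1 : L) else 0)).Local v) ≃ₜ* ((cmDatum L 2 (Matrix.of fun i j : Fin 2 => if i.val + j.val + 1 = 2 then (1 : L) else 0)).Local v × (cmDatum L 1 (Matrix.of fun i j : Fin 1 => if i.val + j.val + 1 = 1 then (1 : L) else 0)).Local v)),
      conjLocal L (IsCMField.complexConj L) v r = r ∧ (∀ w' : PlacesOver L v, Valued.v (r w') = 1) ∧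
      (¬ ∃ z : LocalRing L v, IsUnit z ∧ r = conjLocal L (IsCMField.complexConj L) v z * z) ∧
      (∀ a : ((cmDatum L 2 (Matrix.of fun i j : Fin 2 => if i.val + j.val + 1 = 2 then (1 : L) else 0)).Local v × (cmDatum L 1 (Matrix.of fun i j : Fin 1 => if i.val + j.val + 1 = 1 then (1 : L) else 0)).Local v), ((e a).1.val : GL (Fin 2) (LocalRing L v)) = glDiagonal 2 (LocalRing L v) ![1, hru.unit] * a.1.val * (glDiagonal 2 (LocalRing L v) ![1, hru.unit])⁻¹ ∧
        (e a).2 = a.2) ∧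
      (∀ t : ↥(Subgroup.centralizer ({t₀} : Set ((cmDatum L 2 (Matrix.of fun i j : Fin 2 => if i.val + j.val + 1 = 2 then (1 : L) else 0)).Local v × (cmDatum L 1 (Matrix.of fun i j : Fin 1 => if i.val + j.val + 1 = 1 then (1 : L) else 0)).Local v))), ((e (t : ((cmDatum L 2 (Matrix.of fun i j : Fin 2 => if i.val + j.val + 1 = 2 then (1 : L) else 0)).Local v × (cmDatum L 1 (Matrix.of fun i j : Fin 1 => if i.val + j.val + 1 = 1 then (1 : L) else 0)).Local v))).1.val.val : Matrix (Fin 2) (Fin 2) (LocalRing L v)) * (glDiagonal 2 (LocalRing L v) ![1, hru.unit] * P).val =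
        (glDiagonal 2 (LocalRing L v) ![1, hru.unit] * P).val * Matrix.diagonal ![((P⁻¹).val * ((t : ((cmDatum L 2 (Matrix.of fun i j : Fin 2 => if i.val + j.val + 1 = 2 then (1 : L) else 0)).Local v × (cmDatum L 1 (Matrix.of fun i j : Fin 1 => if i.val + j.val + 1 = 1 then (1 : L) else 0)).Local v)).1.val.val : Matrix (Fin 2) (Fin 2) (LocalRing L v)) * P.val) 0 0, ((P⁻¹).val * ((t : ((cmDatum L 2 (Matrix.of fun i j : Fin 2 => if i.val + j.val + 1 = 2 then (1 : L) else 0)).Local v × (cmDatum L 1 (Matrix.of fun i j : Fin 1 => if i.val + j.val + 1 = 1 then (1 : L) else 0)).Local v)).1.val.val : Matrix (Fin 2) (Fin 2) (LocalRing L v)) * P.val) 1 1]) ∧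
      (∀ t : ↥(Subgroup.centralizer ({t₀} : Set ((cmDatum L 2 (Matrix.of fun i j : Fin 2 => if i.val + j.val + 1 = 2 then (1 : L) else 0)).Local v × (cmDatum L 1 (Matrix.of fun i j : Fin 1 => if i.val + j.val + 1 = 1 then (1 : L) else 0)).Local v))), IsRegularElt ((t : ((cmDatum L 2 (Matrix.of fun i j : Fin 2 => if i.val + j.val + 1 = 2 then (1 : L) else 0)).Local v × (cmDatum L 1 (Matrix.of fun i j : Fin 1 => if i.val + j.val + 1 = 1 then (1 : L) else 0)).Local v)).1.val : GL (Fin 2) (LocalRing L v)) →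
        IsLocalStablyConjH L v (t : ((cmDatum L 2 (Matrix.of fun i j : Fin 2 => if i.val + j.val + 1 = 2 then (1 : L) else 0)).Local v × (cmDatum L 1 (Matrix.of fun i j : Fin 1 => if i.val + j.val + 1 = 1 then (1 : L) else 0)).Local v)) (e (t : ((cmDatum L 2 (Matrix.of fun i j : Fin 2 => if i.val + j.val + 1 = 2 then (1 : L) else 0)).Local v × (cmDatum L 1 (Matrix.of fun i j : Fin 1 => if i.val + j.val + 1 = 1 then (1 : L) else 0)).Local v))) ∧ ¬ IsConj (t : ((cmDatum L 2 (Matrix.of fun i j : Fin 2 => if i.val + j.val + 1 = 2 then (1 : L) else 0)).Local v × (cmDatum L 1 (Matrix.of fun i j : Fin 1 => if i.val + j.val + 1 = 1 then (1 : L) else 0)).Local v)) (e (t : ((cmDatum L 2 (Matrix.of fun i j : Fin 2 => if i.val + j.val + 1 = 2 then (1 : L) else 0)).Local v × (cmDatum L 1 (Matrix.of fun i j : Fin 1 => if i.val + j.val + 1 = 1 then (1 : L) else 0)).Local v)))) ∧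
      (∀ a : ((cmDatum L 2 (Matrix.of fun i j : Fin 2 => if i.val + j.val + 1 = 2 then (1 : L) else 0)).Local v × (cmDatum L 1 (Matrix.of fun i j : Fin 1 => if i.val + j.val + 1 = 1 then (1 : L) else 0)).Local v), e a ∈ ((cmLocalIntegralLevel L 2 (Matrix.of fun i j : Fin 2 => if i.val + j.val + 1 = 2 then (1 : L) else 0) v).prod (cmLocalIntegralLevel L 1 (Matrix.of fun i j : Fin 1 => if i.val + j.val + 1 = 1 then (1 : L) else 0) v) : Subgroup ((cmDatum L 2 (Matrix.of fun i j : Fin 2 => if i.val + j.val + 1 = 2 then (1 : L) else 0)).Local v × (cmDatum L 1 (Matrix.of fun i j : Fin 1 => if i.val + j.val + 1 = 1 then (1 : L) else 0)).Local v)) ↔ a ∈ ((cmLocalIntegralLevel L 2 (Matrix.of fun i j : Fin 2 => if i.val + j.val + 1 = 2 then (1 : L) else 0) v).prod (cmLocalIntegralLevel L 1 (Matrix.of fun i j : Fin 1 => if i.val + j.val + 1 = 1 then (1 : L) else 0) v) : Subgroup ((cmDatum L 2 (Matrix.of fun i j : Fin 2 => if i.val + j.val + 1 = 2 then (1 : L)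 else 0)).Local v × (cmDatum L 1 (Matrix.of fun i j : Fin 1 => if i.val + j.val + 1 = 1 then (1 : L) else 0)).Local v))) ∧
      ∀ (ν : Measure ((cmDatum L 2 (Matrix.of fun i j : Fin 2 => if i.val + j.val + 1 = 2 then (1 : L) else 0)).Local v × (cmDatum L 1 (Matrix.of fun i j : Fin 1 => if i.val + j.val + 1 = 1 then (1 : L) else 0)).Local v)) [ν.IsHaarMeasure], MeasurePreserving e ν ν := by
  classical
  obtain ⟨r, hrσ, hru, hrv, hrn⟩ := exists_integralUnit_conjLocal_eq_not_exists_norm_of_ramified L v w hw he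
  let e : ((cmDatum L 2 (Matrix.of fun i j : Fin 2 => if i.val + j.val + 1 = 2 then (1 : L) else 0)).Local v × (cmDatum L 1 (Matrix.of fun i j : Fin 1 => if i.val + j.val + 1 = 1 then (1 : L) else 0)).Local v) ≃ₜ* ((cmDatum L 2 (Matrix.of fun i j : Fin 2 => if i.val + j.val + 1 = 2 then (1 : L) else 0)).Local v × (cmDatum L 1 (Matrix.of fun i j : Fin 1 => if i.val + j.val + 1 = 1 then (1 : L) else 0)).Local v) :=
    { toFun := fun a => ((cmDatumLocalCongr L v (glDiagonal 2 (LocalRing L v) ![1, hru.unit]) hru (formCongr_diagonal_antidiagTwo L v hru hrσ)) a.1, a.2)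
      invFun := fun a => ((cmDatumLocalCongr L v (glDiagonal 2 (LocalRing L v) ![1, hru.unit]) hru (formCongr_diagonal_antidiagTwo L v hru hrσ)).symm a.1, a.2)
      left_inv := fun a => Prod.ext ((cmDatumLocalCongr L v (glDiagonal 2 (LocalRing L v) ![1, hru.unit]) hru (formCongr_diagonal_antidiagTwo L v hru hrσ)).symm_apply_apply a.1) rfl
      right_inv := fun a => Prod.ext ((cmDatumLocalCongr L v (glDiagonal 2 (LocalRing L v) ![1, hru.unit]) hru (formCongr_diagonal_antidiagTwo L v hru hrσ)).apply_symm_apply a.1) rfl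
      map_mul' := fun x y => Prod.ext (map_mul (cmDatumLocalCongr L v (glDiagonal 2 (LocalRing L v) ![1, hru.unit]) hru (formCongr_diagonal_antidiagTwo L v hru hrσ)) x.1 y.1) rfl
      continuous_toFun := ((cmDatumLocalCongr L v (glDiagonal 2 (LocalRing L v) ![1, hru.unit]) hru (formCongr_diagonal_antidiagTwo L v hru hrσ)).continuous.comp continuous_fst).prodMk continuous_snd
      continuous_invFun := ((cmDatumLocalCongr L v (glDiagonal 2 (LocalRing L v) ![1, hru.unit]) hru (formCongr_diagonal_antidiagTwo L v hru hrσ)).symm.continuous.comp continuous_fst).prodMk continuous_snd }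
  have hea : ∀ a : ((cmDatum L 2 (Matrix.of fun i j : Fin 2 => if i.val + j.val + 1 = 2 then (1 : L) else 0)).Local v × (cmDatum L 1 (Matrix.of fun i j : Fin 1 => if i.val + j.val + 1 = 1 then (1 : L) else 0)).Local v), e a = ((cmDatumLocalCongr L v (glDiagonal 2 (LocalRing L v) ![1, hru.unit]) hru (formCongr_diagonal_antidiagTwo L v hru hrσ)) a.1, a.2) := fun a => rfl
  have hK : ∀ a : ((cmDatum L 2 (Matrix.of fun i j : Fin 2 => if i.val + j.val + 1 = 2 then (1 : L) else 0)).Local v × (cmDatum L 1 (Matrix.of fun i j : Fin 1 => if i.val + j.val + 1 = 1 then (1 : L) else 0)).Local v), e a ∈ ((cmLocalIntegralLevel L 2 (Matrix.of fun i j : Fin 2 => if i.val + j.val + 1 = 2 then (1 : L) else 0) v).prod (cmLocalIntegralLevel L 1 (Matrix.of fun i j : Fin 1 => if i.val + j.val + 1 = 1 then (1 : L) else 0) v) : Subgroup ((cmDatum L 2 (Matrix.of fun i j : Fin 2 => if i.val + j.val + 1 = 2 then (1 : L) else 0)).Local v × (cmDatum L 1 (Matrix.of fun i j : Fin 1 =>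 if i.val + j.val + 1 = 1 then (1 : L) else 0)).Local v)) ↔ a ∈ ((cmLocalIntegralLevel L 2 (Matrix.of fun i j : Fin 2 => if i.val + j.val + 1 = 2 then (1 : L) else 0) v).prod (cmLocalIntegralLevel L 1 (Matrix.of fun i j : Fin 1 => if i.val + j.val + 1 = 1 then (1 : L) else 0) v) : Subgroup ((cmDatum L 2 (Matrix.of fun i j : Fin 2 => if i.val + j.val + 1 = 2 then (1 : L) else 0)).Local v × (cmDatum L 1 (Matrix.of fun i j : Fin 1 => if i.val + j.val + 1 = 1 then (1 : L) else 0)).Local v)) := fun a => by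
    rw [hea]; exact prodMk_cmDatumLocalCongr_mem_prod_iff L v hru hrσ hrv a
  refine ⟨r, hru, e, hrσ, hrv, hrn, fun a => ⟨?_, by rw [hea]⟩, fun t => ?_, fun t ht => ?_, hK, fun ν _ => ?_⟩
  · rw [hea]; exact coe_cmDatumLocalCongr_apply L v _ hru (formCongr_diagonal_antidiagTwo L v hru hrσ) a.1
  · rw [hea]; exact partnerCongr_frame L v w hw hru hrσ t₀ P d ht₀ hP hd1 t
  · rw [hea]; exact isLocalStablyConjH_partnerCongr_not_isConj L v w hw hru hrσ hrn t₀ P d ht₀ hP hd1 t ht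
  · obtain ⟨hKc, hKo⟩ := isCompact_isOpen_cmLocalIntegralLevel_prod L 2 1 (Matrix.of fun i j : Fin 2 => if i.val + j.val + 1 = 2 then (1 : L) else 0) (Matrix.of fun i j : Fin 1 => if i.val + j.val + 1 = 1 then (1 : L) else 0) v
    exact measurePreserving_self_of_forall_mem_iff e hKc hKo (Subgroup.one_mem _) hK ν

/-- **THE SAME PACKAGE IN THE LETTER'S BINDERS `(hv) (hram)`** (architect A-19 ∕ A-21 (c): the (R5b-τ) socket `exists_stablePartner_congr` «of ramified», in F0P2-p01's ★ p843436
shape PLUS the level and Haar clauses): `hv : Subsingleton (PlacesOver L v)`, `hram : ¬ Algebra.IsUnramifiedIn (𝓞 L) v` (the binders of ★ p843417's `hcore_ram`) ⇒ the place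
`w` above `v` is conjugation-fixed and ramified (§2 bridge), and `exists_unitSimilitudePartner_of_ramified` applies.  (The bare socket `∃ τ, Continuous τ ∧ …` at a ramified
place is ALREADY ★ `exists_stablePartner (hv)` — place-agnostic — and is not restated; what the ramified place adds is exactly the LEVEL∕HAAR pair below.)
[cite: LabesseLanglands1979, §2 pp. 8–10] [cite: Rogawski1990, §3.6 pp. 31–32; §4.9 Lemma 4.9.3 p. 56] -/
theorem exists_stablePartner_congr_of_ramified (hv : Subsingleton (PlacesOver L v)) (hram : ¬ Algebra.IsUnramifiedIn (𝓞 L) v.asIdeal)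
    [MeasurableSpace ((cmDatum L 2 (Matrix.of fun i j : Fin 2 => if i.val + j.val + 1 = 2 then (1 : L) else 0)).Local v × (cmDatum L 1 (Matrix.of fun i j : Fin 1 => if i.val + j.val + 1 = 1 then (1 : L) else 0)).Local v)] [BorelSpace ((cmDatum L 2 (Matrix.of fun i j : Fin 2 => if i.val + j.val + 1 = 2 then (1 : L) else 0)).Local v × (cmDatum L 1 (Matrix.of fun i j : Fin 1 => if i.val + j.val + 1 = 1 then (1 : L) else 0)).Local v)]
    (t₀ : ((cmDatum L 2 (Matrix.of fun i j : Fin 2 => if i.val + j.val + 1 = 2 then (1 : L) else 0)).Local v × (cmDatum L 1 (Matrix.of fun i j : Fin 1 => if i.val + j.val + 1 = 1 then (1 : L) else 0)).Local v)) (P : GL (Fin 2) (LocalRing L v)) (d : Fin 2 → (LocalRing L v)) (ht₀ : IsRegularElt (t₀.1.val : GL (Fin 2) (LocalRing L v)))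
    (hP : (t₀.1.val.val : Matrix (Fin 2) (Fin 2) (LocalRing L v)) * P.val = P.val * Matrix.diagonal d) (hd1 : ∀ i, conjLocal L (IsCMField.complexConj L) v (d i) * d i = 1) :
    ∃ (r : LocalRing L v) (hru : IsUnit r) (e : ((cmDatum L 2 (Matrix.of fun i j : Fin 2 => if i.val + j.val + 1 = 2 then (1 : L) else 0)).Local v × (cmDatum L 1 (Matrix.of fun i j : Fin 1 => if i.val + j.val + 1 = 1 then (1 : L) else 0)).Local v) ≃ₜ* ((cmDatum L 2 (Matrix.of fun i j : Fin 2 => if i.val + j.val + 1 = 2 then (1 : L) else 0)).Local v × (cmDatum L 1 (Matrix.of fun i j : Fin 1 => if i.val + j.val + 1 = 1 then (1 : L) else 0)).Local v)),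
      conjLocal L (IsCMField.complexConj L) v r = r ∧ (∀ w' : PlacesOver L v, Valued.v (r w') = 1) ∧
      (¬ ∃ z : LocalRing L v, IsUnit z ∧ r = conjLocal L (IsCMField.complexConj L) v z * z) ∧
      (∀ a : ((cmDatum L 2 (Matrix.of fun i j : Fin 2 => if i.val + j.val + 1 = 2 then (1 : L) else 0)).Local v × (cmDatum L 1 (Matrix.of fun i j : Fin 1 => if i.val + j.val + 1 = 1 then (1 : L) else 0)).Local v), ((e a).1.val : GL (Fin 2) (LocalRing L v)) = glDiagonal 2 (LocalRing L v) ![1, hru.unit] * a.1.val * (glDiagonal 2 (LocalRing L v) ![1, hru.unit])⁻¹ ∧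
        (e a).2 = a.2) ∧
      (∀ t : ↥(Subgroup.centralizer ({t₀} : Set ((cmDatum L 2 (Matrix.of fun i j : Fin 2 => if i.val + j.val + 1 = 2 then (1 : L) else 0)).Local v × (cmDatum L 1 (Matrix.of fun i j : Fin 1 => if i.val + j.val + 1 = 1 then (1 : L) else 0)).Local v))), ((e (t : ((cmDatum L 2 (Matrix.of fun i j : Fin 2 => if i.val + j.val + 1 = 2 then (1 : L) else 0)).Local v × (cmDatum L 1 (Matrix.of fun i j : Fin 1 => if i.val + j.val + 1 = 1 then (1 : L) else 0)).Local v))).1.val.val : Matrix (Fin 2) (Fin 2) (LocalRing L v)) * (glDiagonal 2 (LocalRing L v) ![1, hru.unit] * P).val =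
        (glDiagonal 2 (LocalRing L v) ![1, hru.unit] * P).val * Matrix.diagonal ![((P⁻¹).val * ((t : ((cmDatum L 2 (Matrix.of fun i j : Fin 2 => if i.val + j.val + 1 = 2 then (1 : L) else 0)).Local v × (cmDatum L 1 (Matrix.of fun i j : Fin 1 => if i.val + j.val + 1 = 1 then (1 : L) else 0)).Local v)).1.val.val : Matrix (Fin 2) (Fin 2) (LocalRing L v)) * P.val) 0 0, ((P⁻¹).val * ((t : ((cmDatum L 2 (Matrix.of fun i j : Fin 2 => if i.val + j.val + 1 = 2 then (1 : L) else 0)).Local v × (cmDatum L 1 (Matrix.of fun i j : Fin 1 => if i.val + j.val + 1 = 1 then (1 : L) else 0)).Local v)).1.val.val : Matrix (Fin 2) (Fin 2) (LocalRing L v)) * P.val) 1 1]) ∧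
      (∀ t : ↥(Subgroup.centralizer ({t₀} : Set ((cmDatum L 2 (Matrix.of fun i j : Fin 2 => if i.val + j.val + 1 = 2 then (1 : L) else 0)).Local v × (cmDatum L 1 (Matrix.of fun i j : Fin 1 => if i.val + j.val + 1 = 1 then (1 : L) else 0)).Local v))), IsRegularElt ((t : ((cmDatum L 2 (Matrix.of fun i j : Fin 2 => if i.val + j.val + 1 = 2 then (1 : L) else 0)).Local v × (cmDatum L 1 (Matrix.of fun i j : Fin 1 => if i.val + j.val + 1 = 1 then (1 : L) else 0)).Local v)).1.val : GL (Fin 2) (LocalRing L v)) →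
        IsLocalStablyConjH L v (t : ((cmDatum L 2 (Matrix.of fun i j : Fin 2 => if i.val + j.val + 1 = 2 then (1 : L) else 0)).Local v × (cmDatum L 1 (Matrix.of fun i j : Fin 1 => if i.val + j.val + 1 = 1 then (1 : L) else 0)).Local v)) (e (t : ((cmDatum L 2 (Matrix.of fun i j : Fin 2 => if i.val + j.val + 1 = 2 then (1 : L) else 0)).Local v × (cmDatum L 1 (Matrix.of fun i j : Fin 1 => if i.val + j.val + 1 = 1 then (1 : L) else 0)).Local v))) ∧ ¬ IsConj (t : ((cmDatum L 2 (Matrix.of fun i j : Fin 2 => if i.val + j.val + 1 = 2 then (1 : L) else 0)).Local v × (cmDatum L 1 (Matrix.of fun i j : Fin 1 => if i.val + j.val + 1 = 1 then (1 : L) else 0)).Local v)) (e (t : ((cmDatum L 2 (Matrix.of fun i j : Fin 2 => if i.val + j.val + 1 = 2 then (1 : L) else 0)).Local v × (cmDatum L 1 (Matrix.of fun i j : Fin 1 => if i.val + j.val + 1 = 1 then (1 : L) else 0)).Local v)))) ∧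
      (∀ a : ((cmDatum L 2 (Matrix.of fun i j : Fin 2 => if i.val + j.val + 1 = 2 then (1 : L) else 0)).Local v × (cmDatum L 1 (Matrix.of fun i j : Fin 1 => if i.val + j.val + 1 = 1 then (1 : L) else 0)).Local v), e a ∈ ((cmLocalIntegralLevel L 2 (Matrix.of fun i j : Fin 2 => if i.val + j.val + 1 = 2 then (1 : L) else 0) v).prod (cmLocalIntegralLevel L 1 (Matrix.of fun i j : Fin 1 => if i.val + j.val + 1 = 1 then (1 : L) else 0) v) : Subgroup ((cmDatum L 2 (Matrix.of fun i j : Fin 2 => if i.val + j.val + 1 = 2 then (1 : L) else 0)).Local v × (cmDatum L 1 (Matrix.of fun i j : Fin 1 => if i.val + j.val + 1 = 1 then (1 : L) else 0)).Local v)) ↔ a ∈ ((cmLocalIntegralLevel L 2 (Matrix.of fun i j : Fin 2 => if i.val + j.val + 1 = 2 then (1 : L) else 0) v).prod (cmLocalIntegralLevel L 1 (Matrix.of fun i j : Fin 1 => if i.val + j.val + 1 = 1 then (1 : L) else 0) v) : Subgroup ((cmDatum L 2 (Matrix.of fun i j : Fin 2 => if i.val + j.val + 1 = 2 then (1 : L)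 else 0)).Local v × (cmDatum L 1 (Matrix.of fun i j : Fin 1 => if i.val + j.val + 1 = 1 then (1 : L) else 0)).Local v))) ∧
      ∀ (ν : Measure ((cmDatum L 2 (Matrix.of fun i j : Fin 2 => if i.val + j.val + 1 = 2 then (1 : L) else 0)).Local v × (cmDatum L 1 (Matrix.of fun i j : Fin 1 => if i.val + j.val + 1 = 1 then (1 : L) else 0)).Local v)) [ν.IsHaarMeasure], MeasurePreserving e ν ν := by
  obtain ⟨w⟩ := PlacesOver.nonempty L v
  exact exists_unitSimilitudePartner_of_ramified L v w (smul_eq_of_subsingleton_placesOver₁₄ L v hv w)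
    (ramificationIdx'_ne_one_of_not_isUnramifiedIn L v hv hram w) t₀ P d ht₀ hP hd1

end Package

/-! ## §5 R-1: the orbital integral at the stable partner is the orbital integral of the pulled-back test function; the RAMIFIED UNIT ROW is ZERO -/

section UnitRow

/-- `(X − a)(X − b)` separable ⇒ `a ≠ b`. [folklore] -/
private theorem ne_of_separable_X_sub_C_mul₁₁ {K : Type*} [Field K] {a b : K} (h : ((X - C a) * (X - C b)).Separable) : a ≠ b := by
  rintro rfl
  exact Polynomial.not_isUnit_X_sub_C a (isCoprime_self.1 h.isCoprime)

/-- `![a, b]` is injective when `a ≠ b`. [folklore] -/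
private theorem injective_vecCons_two₁₁ {K : Type*} {a b : K} (h : a ≠ b) : Function.Injective ![a, b] := by
  intro i j hij
  fin_cases i <;> fin_cases j
  · rfl
  · exact absurd hij h
  · exact absurd hij.symm h
  · rfl

variable (L : Type) [Field L] [NumberField L] [IsCMField L] (v : HeightOneSpectrum (𝓞 ↥(maximalRealSubfield L)))

/-- **TWO CLASSES ⇒ every admissible `t′` is conjugate to the partner.**  For `t ∈ Z(t₀)` with `t.1` regular (framed by ★ `normOne_frame_of_mem_centralizer` with an injective
norm-one diagonal), a fixed `t₁` stably conjugate and NOT conjugate to `t`, and ANY `t′` stably conjugate and not conjugate to `t`: `t₁` and `t′` are `H_v`-conjugate — the stable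
class of `t` has exactly two classes (★ `exists_isLocalStablyConjH_not_isConj_forall_isConj_or`). [cite: Rogawski1990, §3.5 Prop. 3.5.2 (c) p. 29; §3.6 p. 31] -/
theorem isConj_of_stablePartner_of_not_isConj (w : PlacesOver L v) (hw : IsCMField.complexConj L • w.1 = w.1)
    (t₀ : ((cmDatum L 2 (Matrix.of fun i j : Fin 2 => if i.val + j.val + 1 = 2 then (1 : L) else 0)).Local v × (cmDatum L 1 (Matrix.of fun i j : Fin 1 => if i.val + j.val + 1 = 1 then (1 : L) else 0)).Local v)) (P : GL (Fin 2) (LocalRing L v)) (d : Fin 2 → (LocalRing L v)) (ht₀ : IsRegularElt (t₀.1.val : GL (Fin 2) (LocalRing L v)))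
    (hP : (t₀.1.val.val : Matrix (Fin 2) (Fin 2) (LocalRing L v)) * P.val = P.val * Matrix.diagonal d) (hd1 : ∀ i, conjLocal L (IsCMField.complexConj L) v (d i) * d i = 1)
    (t : ↥(Subgroup.centralizer ({t₀} : Set ((cmDatum L 2 (Matrix.of fun i j : Fin 2 => if i.val + j.val + 1 = 2 then (1 : L) else 0)).Local v × (cmDatum L 1 (Matrix.of fun i j : Fin 1 => if i.val + j.val + 1 = 1 then (1 : L) else 0)).Local v)))) (ht : IsRegularElt ((t : ((cmDatum L 2 (Matrix.of fun i j : Fin 2 => if i.val + j.val + 1 = 2 then (1 : L) else 0)).Local v × (cmDatum L 1 (Matrix.of fun i j : Fin 1 => if i.val + j.val + 1 = 1 then (1 : L) else 0)).Local v)).1.val : GL (Fin 2) (LocalRing L v)))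
    {t₁ : ((cmDatum L 2 (Matrix.of fun i j : Fin 2 => if i.val + j.val + 1 = 2 then (1 : L) else 0)).Local v × (cmDatum L 1 (Matrix.of fun i j : Fin 1 => if i.val + j.val + 1 = 1 then (1 : L) else 0)).Local v)} (h₁ : IsLocalStablyConjH L v (t : ((cmDatum L 2 (Matrix.of fun i j : Fin 2 => if i.val + j.val + 1 = 2 then (1 : L) else 0)).Local v × (cmDatum L 1 (Matrix.of fun i j : Fin 1 => if i.val + j.val + 1 = 1 then (1 : L) else 0)).Local v)) t₁ ∧ ¬ IsConj (t : ((cmDatum L 2 (Matrix.of fun i j : Fin 2 => if i.val + j.val + 1 = 2 then (1 : L) else 0)).Local v × (cmDatum L 1 (Matrix.of fun i j : Fin 1 => if i.val + j.val + 1 = 1 then (1 : L) else 0)).Local v)) t₁)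
    {t' : ((cmDatum L 2 (Matrix.of fun i j : Fin 2 => if i.val + j.val + 1 = 2 then (1 : L) else 0)).Local v × (cmDatum L 1 (Matrix.of fun i j : Fin 1 => if i.val + j.val + 1 = 1 then (1 : L) else 0)).Local v)} (hst : IsLocalStablyConjH L v (t : ((cmDatum L 2 (Matrix.of fun i j : Fin 2 => if i.val + j.val + 1 = 2 then (1 : L) else 0)).Local v × (cmDatum L 1 (Matrix.of fun i j : Fin 1 => if i.val + j.val + 1 = 1 then (1 : L) else 0)).Local v)) t') (hnc : ¬ IsConj (t : ((cmDatum L 2 (Matrix.of fun i j : Fin 2 => if i.val + j.val + 1 = 2 then (1 : L) else 0)).Local v × (cmDatum L 1 (Matrix.of fun i j : Fin 1 => if i.val + j.val + 1 = 1 then (1 : L) else 0)).Local v)) t') : IsConj t₁ t' := by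
  classical
  letI : Field (LocalRing L v) := (LocalRing.isField_of_smul_eq (IsCMField.complexConj L) (IsCMField.complexConj_ne_one L) w hw).toField
  obtain ⟨hn1, hPt⟩ := normOne_frame_of_mem_centralizer L v w hw t₀ P d ht₀ hP hd1 _ t.2
  have hinj : Function.Injective ![((P⁻¹).val * ((t : ((cmDatum L 2 (Matrix.of fun i j : Fin 2 => if i.val + j.val + 1 = 2 then (1 : L) else 0)).Local v × (cmDatum L 1 (Matrix.of fun i j : Fin 1 => if i.val + j.val + 1 = 1 then (1 : L) else 0)).Local v)).1.val.val : Matrix (Fin 2) (Fin 2) (LocalRing L v)) * P.val) 0 0, ((P⁻¹).val * ((t : ((cmDatum L 2 (Matrix.of fun i j : Fin 2 => if i.val + j.val + 1 = 2 then (1 : L) else 0)).Local v × (cmDatum L 1 (Matrix.of fun i j : Fin 1 => if i.val + j.val + 1 = 1 then (1 : L) else 0)).Local v)).1.val.val : Matrix (Fin 2) (Fin 2) (LocalRing L v)) * P.val) 1 1] := by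
    have hχ := finCharpolyTwo_eq_of_frame P hPt
    have hsep : (finCharpolyTwo L v (t : ((cmDatum L 2 (Matrix.of fun i j : Fin 2 => if i.val + j.val + 1 = 2 then (1 : L) else 0)).Local v × (cmDatum L 1 (Matrix.of fun i j : Fin 1 => if i.val + j.val + 1 = 1 then (1 : L) else 0)).Local v))).Separable := ht
    rw [hχ] at hsep
    exact injective_vecCons_two₁₁ (ne_of_separable_X_sub_C_mul₁₁ hsep)
  obtain ⟨h', -, -, hall⟩ := exists_isLocalStablyConjH_not_isConj_forall_isConj_or L w hw hPt hinj hn1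
  have h1 : IsConj h' t₁ := (hall t₁ h₁.1).resolve_left h₁.2
  have h2 : IsConj h' t' := (hall t' hst).resolve_left hnc
  exact h1.symm.trans h2

/-- **R-1: THE ORBITAL INTEGRAL AT THE OTHER CLASS IS THE ORBITAL INTEGRAL OF THE PULLED-BACK TEST FUNCTION.**  For a Haar-preserving automorphism `e : H_v ≃ₜ* H_v` with `e t`
stably conjugate and not conjugate to `t` (`t ∈ Z(t₀)`, `t.1` regular), a right-invariant Haar `ν`, every `f`, and EVERY `t′` stably conjugate and not conjugate to `t`:
`∫ f(y t′ y⁻¹) dν = ∫ (f ∘ e)(y t y⁻¹) dν` (`t′ ~ e t` by two classes, class function, §1 substitution).  This is the `O(t′, f) = O(t, f ∘ Ad_h)` of MEMO-R1ram §2 for the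
abstract `t′` of `hcore`. [cite: LabesseLanglands1979, §2 p. 9] [cite: Rogawski1990, §4.9 Lemma 4.9.3 (4.9.2) p. 56; §4.3 (4.3.1) p. 43] -/
theorem integral_conj_eq_integral_comp_of_stablePartner (w : PlacesOver L v) (hw : IsCMField.complexConj L • w.1 = w.1)
    [MeasurableSpace ((cmDatum L 2 (Matrix.of fun i j : Fin 2 => if i.val + j.val + 1 = 2 then (1 : L) else 0)).Local v × (cmDatum L 1 (Matrix.of fun i j : Fin 1 => if i.val + j.val + 1 = 1 then (1 : L) else 0)).Local v)] [BorelSpace ((cmDatum L 2 (Matrix.of fun i j : Fin 2 => if i.val + j.val + 1 = 2 then (1 : L) else 0)).Local v × (cmDatum L 1 (Matrix.of fun i j : Fin 1 => if i.val + j.val + 1 = 1 then (1 : L) else 0)).Local v)] (ν : Measure ((cmDatum L 2 (Matrix.of fun i j : Fin 2 => if i.val + j.val + 1 = 2 then (1 : L) else 0)).Local v × (cmDatum L 1 (Matrix.of fun i j : Fin 1 => if i.val + j.val + 1 = 1 then (1 : L) else 0)).Local v)) [ν.IsMulRightInvariant]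
    (e : ((cmDatum L 2 (Matrix.of fun i j : Fin 2 => if i.val + j.val + 1 = 2 then (1 : L) else 0)).Local v × (cmDatum L 1 (Matrix.of fun i j : Fin 1 => if i.val + j.val + 1 = 1 then (1 : L) else 0)).Local v) ≃ₜ* ((cmDatum L 2 (Matrix.of fun i j : Fin 2 => if i.val + j.val + 1 = 2 then (1 : L) else 0)).Local v × (cmDatum L 1 (Matrix.of fun i j : Fin 1 => if i.val + j.val + 1 = 1 then (1 : L) else 0)).Local v)) (heν : MeasurePreserving e ν ν)
    (t₀ : ((cmDatum L 2 (Matrix.of fun i j : Fin 2 => if i.val + j.val + 1 = 2 then (1 : L) else 0)).Local v × (cmDatum L 1 (Matrix.of fun i j : Fin 1 => if i.val + j.val + 1 = 1 then (1 : L) else 0)).Local v)) (P : GL (Fin 2) (LocalRing L v)) (d : Fin 2 → (LocalRing L v)) (ht₀ : IsRegularElt (t₀.1.val : GL (Fin 2) (LocalRing L v)))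
    (hP : (t₀.1.val.val : Matrix (Fin 2) (Fin 2) (LocalRing L v)) * P.val = P.val * Matrix.diagonal d) (hd1 : ∀ i, conjLocal L (IsCMField.complexConj L) v (d i) * d i = 1)
    (t : ↥(Subgroup.centralizer ({t₀} : Set ((cmDatum L 2 (Matrix.of fun i j : Fin 2 => if i.val + j.val + 1 = 2 then (1 : L) else 0)).Local v × (cmDatum L 1 (Matrix.of fun i j : Fin 1 => if i.val + j.val + 1 = 1 then (1 : L) else 0)).Local v)))) (ht : IsRegularElt ((t : ((cmDatum L 2 (Matrix.of fun i j : Fin 2 => if i.val + j.val + 1 = 2 then (1 : L) else 0)).Local v × (cmDatum L 1 (Matrix.of fun i j : Fin 1 => if i.val + j.val + 1 = 1 then (1 : L) else 0)).Local v)).1.val : GL (Fin 2) (LocalRing L v)))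
    (hest : IsLocalStablyConjH L v (t : ((cmDatum L 2 (Matrix.of fun i j : Fin 2 => if i.val + j.val + 1 = 2 then (1 : L) else 0)).Local v × (cmDatum L 1 (Matrix.of fun i j : Fin 1 => if i.val + j.val + 1 = 1 then (1 : L) else 0)).Local v)) (e (t : ((cmDatum L 2 (Matrix.of fun i j : Fin 2 => if i.val + j.val + 1 = 2 then (1 : L) else 0)).Local v × (cmDatum L 1 (Matrix.of fun i j : Fin 1 => if i.val + j.val + 1 = 1 then (1 : L) else 0)).Local v))) ∧ ¬ IsConj (t : ((cmDatum L 2 (Matrix.of fun i j : Fin 2 => if i.val + j.val + 1 = 2 then (1 : L) else 0)).Local v × (cmDatum L 1 (Matrix.of fun i j : Fin 1 => if i.val + j.val + 1 = 1 then (1 : L) else 0)).Local v)) (e (t : ((cmDatum L 2 (Matrix.of fun i j : Fin 2 => if i.val + j.val + 1 = 2 then (1 : L) else 0)).Local v × (cmDatum L 1 (Matrix.of fun i j : Fin 1 => if i.val + j.val + 1 = 1 then (1 : L) else 0)).Local v))))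
    (t' : ((cmDatum L 2 (Matrix.of fun i j : Fin 2 => if i.val + j.val + 1 = 2 then (1 : L) else 0)).Local v × (cmDatum L 1 (Matrix.of fun i j : Fin 1 => if i.val + j.val + 1 = 1 then (1 : L) else 0)).Local v)) (hst : IsLocalStablyConjH L v (t : ((cmDatum L 2 (Matrix.of fun i j : Fin 2 => if i.val + j.val + 1 = 2 then (1 : L) else 0)).Local v × (cmDatum L 1 (Matrix.of fun i j : Fin 1 => if i.val + j.val + 1 = 1 then (1 : L) else 0)).Local v)) t') (hnc : ¬ IsConj (t : ((cmDatum L 2 (Matrix.of fun i j : Fin 2 => if i.val + j.val + 1 = 2 then (1 : L) else 0)).Local v × (cmDatum L 1 (Matrix.of fun i j : Fin 1 => if i.val + j.val + 1 = 1 then (1 : L) else 0)).Local v)) t') (f : ((cmDatum L 2 (Matrix.of fun i j : Fin 2 => if i.val + j.val + 1 = 2 then (1 : L) else 0)).Local v × (cmDatum L 1 (Matrix.of fun i j : Fin 1 => if i.val + j.val + 1 = 1 then (1 : L) else 0)).Local v) → ℂ) :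
    ∫ y, f (y * t' * y⁻¹) ∂ν = ∫ y, (f ∘ e) (y * (t : ((cmDatum L 2 (Matrix.of fun i j : Fin 2 => if i.val + j.val + 1 = 2 then (1 : L) else 0)).Local v × (cmDatum L 1 (Matrix.of fun i j : Fin 1 => if i.val + j.val + 1 = 1 then (1 : L) else 0)).Local v)) * y⁻¹) ∂ν := by
  rw [integral_conj_eq_of_isConj₁₁ ν f (isConj_of_stablePartner_of_not_isConj L v w hw t₀ P d ht₀ hP hd1 t ht hest hst hnc),
    integral_conj_map_eq_integral_comp_conj ν e heν f (t : ((cmDatum L 2 (Matrix.of fun i j : Fin 2 => if i.val + j.val + 1 = 2 then (1 : L) else 0)).Local v × (cmDatum L 1 (Matrix.of fun i j : Fin 1 => if i.val + j.val + 1 = 1 then (1 : L) else 0)).Local v))]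

/-- **THE RAMIFIED κ-DIFFERENCE VANISHES ON `e`-INVARIANT TEST FUNCTIONS** (`hcore_ram`'s tokens verbatim): with the data of `integral_conj_eq_integral_comp_of_stablePartner`
and `f ∘ e = f`: `Δ(t) · (O_ν(t, f) − O_ν(t′, f)) = 0` for every admissible `t′` — LL's «`φ^T(γ, f) = 0` if `L` is ramified» for every `Ad_h`-invariant `f` (all indicators of
`diag(1,u)`-stable levels: `K_H`, its congruence subgroups, the Iwahori). [cite: LabesseLanglands1979, §2 pp. 9–10] [cite: Rogawski1990, §4.9 Lemma 4.9.3 (4.9.2) p. 56] -/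
theorem rankOneDelta_mul_sub_integral_eq_zero_of_comp_eq (w : PlacesOver L v) (hw : IsCMField.complexConj L • w.1 = w.1) (μ : HeckeCharacter L)
    [MeasurableSpace ((cmDatum L 2 (Matrix.of fun i j : Fin 2 => if i.val + j.val + 1 = 2 then (1 : L) else 0)).Local v × (cmDatum L 1 (Matrix.of fun i j : Fin 1 => if i.val + j.val + 1 = 1 then (1 : L) else 0)).Local v)] [BorelSpace ((cmDatum L 2 (Matrix.of fun i j : Fin 2 => if i.val + j.val + 1 = 2 then (1 : L) else 0)).Local v × (cmDatum L 1 (Matrix.of fun i j : Fin 1 => if i.val + j.val + 1 = 1 then (1 : L) else 0)).Local v)] (ν : Measure ((cmDatum L 2 (Matrix.of fun i j : Fin 2 => if i.val + j.val + 1 = 2 then (1 : L) else 0)).Local v × (cmDatum L 1 (Matrix.of fun i j : Fin 1 => if i.val + j.val + 1 = 1 then (1 : L) else 0)).Local v)) [ν.IsMulRightInvariant]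
    (e : ((cmDatum L 2 (Matrix.of fun i j : Fin 2 => if i.val + j.val + 1 = 2 then (1 : L) else 0)).Local v × (cmDatum L 1 (Matrix.of fun i j : Fin 1 => if i.val + j.val + 1 = 1 then (1 : L) else 0)).Local v) ≃ₜ* ((cmDatum L 2 (Matrix.of fun i j : Fin 2 => if i.val + j.val + 1 = 2 then (1 : L) else 0)).Local v × (cmDatum L 1 (Matrix.of fun i j : Fin 1 => if i.val + j.val + 1 = 1 then (1 : L) else 0)).Local v)) (heν : MeasurePreserving e ν ν) (f : ((cmDatum L 2 (Matrix.of fun i j : Fin 2 => if i.val + j.val + 1 = 2 then (1 : L) else 0)).Local v × (cmDatum L 1 (Matrix.of fun i j : Fin 1 => if i.val + j.val + 1 = 1 then (1 : L) else 0)).Local v) → ℂ) (hfix : f ∘ e = f)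
    (t₀ : ((cmDatum L 2 (Matrix.of fun i j : Fin 2 => if i.val + j.val + 1 = 2 then (1 : L) else 0)).Local v × (cmDatum L 1 (Matrix.of fun i j : Fin 1 => if i.val + j.val + 1 = 1 then (1 : L) else 0)).Local v)) (P : GL (Fin 2) (LocalRing L v)) (d : Fin 2 → (LocalRing L v)) (ht₀ : IsRegularElt (t₀.1.val : GL (Fin 2) (LocalRing L v)))
    (hP : (t₀.1.val.val : Matrix (Fin 2) (Fin 2) (LocalRing L v)) * P.val = P.val * Matrix.diagonal d) (hd1 : ∀ i, conjLocal L (IsCMField.complexConj L) v (d i) * d i = 1)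
    (t : ↥(Subgroup.centralizer ({t₀} : Set ((cmDatum L 2 (Matrix.of fun i j : Fin 2 => if i.val + j.val + 1 = 2 then (1 : L) else 0)).Local v × (cmDatum L 1 (Matrix.of fun i j : Fin 1 => if i.val + j.val + 1 = 1 then (1 : L) else 0)).Local v)))) (ht : IsRegularElt ((t : ((cmDatum L 2 (Matrix.of fun i j : Fin 2 => if i.val + j.val + 1 = 2 then (1 : L) else 0)).Local v × (cmDatum L 1 (Matrix.of fun i j : Fin 1 => if i.val + j.val + 1 = 1 then (1 : L) else 0)).Local v)).1.val : GL (Fin 2) (LocalRing L v)))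
    (hest : IsLocalStablyConjH L v (t : ((cmDatum L 2 (Matrix.of fun i j : Fin 2 => if i.val + j.val + 1 = 2 then (1 : L) else 0)).Local v × (cmDatum L 1 (Matrix.of fun i j : Fin 1 => if i.val + j.val + 1 = 1 then (1 : L) else 0)).Local v)) (e (t : ((cmDatum L 2 (Matrix.of fun i j : Fin 2 => if i.val + j.val + 1 = 2 then (1 : L) else 0)).Local v × (cmDatum L 1 (Matrix.of fun i j : Fin 1 => if i.val + j.val + 1 = 1 then (1 : L) else 0)).Local v))) ∧ ¬ IsConj (t : ((cmDatum L 2 (Matrix.of fun i j : Fin 2 => if i.val + j.val + 1 = 2 then (1 : L) else 0)).Local v × (cmDatum L 1 (Matrix.of fun i j : Fin 1 => if i.val + j.val + 1 = 1 then (1 : L) else 0)).Local v)) (e (t : ((cmDatum L 2 (Matrix.of fun i j : Fin 2 => if i.val + j.val + 1 = 2 then (1 : L) else 0)).Local v × (cmDatum L 1 (Matrix.of fun i j : Fin 1 => if i.val + j.val + 1 = 1 then (1 : L) else 0)).Local v))))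
    (t' : ((cmDatum L 2 (Matrix.of fun i j : Fin 2 => if i.val + j.val + 1 = 2 then (1 : L) else 0)).Local v × (cmDatum L 1 (Matrix.of fun i j : Fin 1 => if i.val + j.val + 1 = 1 then (1 : L) else 0)).Local v)) (hst : IsLocalStablyConjH L v (t : ((cmDatum L 2 (Matrix.of fun i j : Fin 2 => if i.val + j.val + 1 = 2 then (1 : L) else 0)).Local v × (cmDatum L 1 (Matrix.of fun i j : Fin 1 => if i.val + j.val + 1 = 1 then (1 : L) else 0)).Local v)) t') (hnc : ¬ IsConj (t : ((cmDatum L 2 (Matrix.of fun i j : Fin 2 => if i.val + j.val + 1 = 2 then (1 : L) else 0)).Local v × (cmDatum L 1 (Matrix.of fun i j : Fin 1 => if i.val + j.val + 1 = 1 then (1 : L) else 0)).Local v)) t') :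
    ((finHeckeValue L v μ (((P⁻¹).val * ((t : ((cmDatum L 2 (Matrix.of fun i j : Fin 2 => if i.val + j.val + 1 = 2 then (1 : L) else 0)).Local v × (cmDatum L 1 (Matrix.of fun i j : Fin 1 => if i.val + j.val + 1 = 1 then (1 : L) else 0)).Local v)).1.val.val : Matrix (Fin 2) (Fin 2) (LocalRing L v)) * P.val) 0 0 - ((P⁻¹).val * ((t : ((cmDatum L 2 (Matrix.of fun i j : Fin 2 => if i.val + j.val + 1 = 2 then (1 : L) else 0)).Local v × (cmDatum L 1 (Matrix.of fun i j : Fin 1 => if i.val + j.val + 1 = 1 then (1 : L) else 0)).Local v)).1.val.val : Matrix (Fin 2) (Fin 2) (LocalRing L v)) * P.val) 1 1))⁻¹ : ℂ) *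
          ((Real.sqrt (∏ w' : PlacesOver L v, ‖(((P⁻¹).val * ((t : ((cmDatum L 2 (Matrix.of fun i j : Fin 2 => if i.val + j.val + 1 = 2 then (1 : L) else 0)).Local v × (cmDatum L 1 (Matrix.of fun i j : Fin 1 => if i.val + j.val + 1 = 1 then (1 : L) else 0)).Local v)).1.val.val : Matrix (Fin 2) (Fin 2) (LocalRing L v)) * P.val) 0 0 - ((P⁻¹).val * ((t : ((cmDatum L 2 (Matrix.of fun i j : Fin 2 => if i.val + j.val + 1 = 2 then (1 : L) else 0)).Local v × (cmDatum L 1 (Matrix.of fun i j : Fin 1 => if i.val + j.val + 1 = 1 then (1 : L) else 0)).Local v)).1.val.val : Matrix (Fin 2) (Fin 2) (LocalRing L v)) * P.val) 1 1) w'‖) : ℝ) : ℂ) * ((∫ y, f (y * (t : ((cmDatum L 2 (Matrix.of fun i j : Fin 2 => if i.val + j.val + 1 = 2 then (1 : L) else 0)).Local v × (cmDatum L 1 (Matrix.of fun i j : Fin 1 => if i.val + j.val + 1 = 1 then (1 : L) else 0)).Local v)) * y⁻¹) ∂ν) - ∫ y, f (y * t' * y⁻¹) ∂ν) = 0 :=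 by
  rw [integral_conj_eq_integral_comp_of_stablePartner L v w hw ν e heν t₀ P d ht₀ hP hd1 t ht hest t' hst hnc f, hfix, sub_self, mul_zero]

/-- **THE RAMIFIED UNIT ROW, DISCHARGED: at a RAMIFIED non-split place the κ-orbital difference of the UNIT `𝟙_{K_H}` is ZERO at every regular point of every elliptic
torus** — `Δ(t) · (O_ν(t, 𝟙_{K_H}) − O_ν(t′, 𝟙_{K_H})) = 0` for every Haar `ν` on `H_v`, every Hecke character `μ` inside `Δ`, every elliptic regular frame `(t₀, P, d)`, every
`t ∈ Z(t₀)` with `t.1` regular and every `t′` stably conjugate and not conjugate to `t` (the partner `e = (Ad diag(1,r), id)` of §4 has `𝟙_{K_H} ∘ e = 𝟙_{K_H}` and preserves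
`ν`).  Print: «Suppose f is the characteristic function of G(O_F) divided by its measure. It is clear that `φ^T(γ, f) = 0` if `L` is ramified» [LabesseLanglands1979 p. 9]; the
(σ)-row of the ramified books, `fC = 0` — contrast the inert unit ★ `rankOne_lhs_indicator_eq_of_eigenframe_of_guard` (`μ_v(u₁)⁻¹ C⁻¹ (−1)^e ≠ 0`).
[cite: LabesseLanglands1979, §2 pp. 9–10] [cite: Rogawski1990, §4.9 Lemma 4.9.3 (4.9.2) p. 56; Prop. 4.9.1 (b) p. 55] -/
theorem rankOneDelta_mul_sub_integral_indicator_eq_zero_of_ramified (w : PlacesOver L v) (hw : IsCMField.complexConj L • w.1 = w.1)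
    (he : v.asIdeal.ramificationIdx' w.1.asIdeal ≠ 1) (μ : HeckeCharacter L)
    [MeasurableSpace ((cmDatum L 2 (Matrix.of fun i j : Fin 2 => if i.val + j.val + 1 = 2 then (1 : L) else 0)).Local v × (cmDatum L 1 (Matrix.of fun i j : Fin 1 => if i.val + j.val + 1 = 1 then (1 : L) else 0)).Local v)] [BorelSpace ((cmDatum L 2 (Matrix.of fun i j : Fin 2 => if i.val + j.val + 1 = 2 then (1 : L) else 0)).Local v × (cmDatum L 1 (Matrix.of fun i j : Fin 1 => if i.val + j.val + 1 = 1 then (1 : L) else 0)).Local v)] (ν : Measure ((cmDatum L 2 (Matrix.of fun i j : Fin 2 => if i.val + j.val + 1 = 2 then (1 : L) else 0)).Local v × (cmDatum L 1 (Matrix.of fun i j : Fin 1 => if i.val + j.val + 1 = 1 then (1 : L) else 0)).Local v)) [ν.IsHaarMeasure] [ν.IsMulRightInvariant]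
    (t₀ : ((cmDatum L 2 (Matrix.of fun i j : Fin 2 => if i.val + j.val + 1 = 2 then (1 : L) else 0)).Local v × (cmDatum L 1 (Matrix.of fun i j : Fin 1 => if i.val + j.val + 1 = 1 then (1 : L) else 0)).Local v)) (P : GL (Fin 2) (LocalRing L v)) (d : Fin 2 → (LocalRing L v)) (ht₀ : IsRegularElt (t₀.1.val : GL (Fin 2) (LocalRing L v)))
    (hP : (t₀.1.val.val : Matrix (Fin 2) (Fin 2) (LocalRing L v)) * P.val = P.val * Matrix.diagonal d) (hd1 : ∀ i, conjLocal L (IsCMField.complexConj L) v (d i) * d i = 1)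
    (t : ↥(Subgroup.centralizer ({t₀} : Set ((cmDatum L 2 (Matrix.of fun i j : Fin 2 => if i.val + j.val + 1 = 2 then (1 : L) else 0)).Local v × (cmDatum L 1 (Matrix.of fun i j : Fin 1 => if i.val + j.val + 1 = 1 then (1 : L) else 0)).Local v)))) (ht : IsRegularElt ((t : ((cmDatum L 2 (Matrix.of fun i j : Fin 2 => if i.val + j.val + 1 = 2 then (1 : L) else 0)).Local v × (cmDatum L 1 (Matrix.of fun i j : Fin 1 => if i.val + j.val + 1 = 1 then (1 : L) else 0)).Local v)).1.val : GL (Fin 2) (LocalRing L v)))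
    (t' : ((cmDatum L 2 (Matrix.of fun i j : Fin 2 => if i.val + j.val + 1 = 2 then (1 : L) else 0)).Local v × (cmDatum L 1 (Matrix.of fun i j : Fin 1 => if i.val + j.val + 1 = 1 then (1 : L) else 0)).Local v)) (hst : IsLocalStablyConjH L v (t : ((cmDatum L 2 (Matrix.of fun i j : Fin 2 => if i.val + j.val + 1 = 2 then (1 : L) else 0)).Local v × (cmDatum L 1 (Matrix.of fun i j : Fin 1 => if i.val + j.val + 1 = 1 then (1 : L) else 0)).Local v)) t') (hnc : ¬ IsConj (t : ((cmDatum L 2 (Matrix.of fun i j : Fin 2 => if i.val + j.val + 1 = 2 then (1 : L) else 0)).Local v × (cmDatum L 1 (Matrix.of fun i j : Fin 1 => if i.val + j.val + 1 = 1 then (1 : L) else 0)).Local v)) t') :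
    ((finHeckeValue L v μ (((P⁻¹).val * ((t : ((cmDatum L 2 (Matrix.of fun i j : Fin 2 => if i.val + j.val + 1 = 2 then (1 : L) else 0)).Local v × (cmDatum L 1 (Matrix.of fun i j : Fin 1 => if i.val + j.val + 1 = 1 then (1 : L) else 0)).Local v)).1.val.val : Matrix (Fin 2) (Fin 2) (LocalRing L v)) * P.val) 0 0 - ((P⁻¹).val * ((t : ((cmDatum L 2 (Matrix.of fun i j : Fin 2 => if i.val + j.val + 1 = 2 then (1 : L) else 0)).Local v × (cmDatum L 1 (Matrix.of fun i j : Fin 1 => if i.val + j.val + 1 = 1 then (1 : L) else 0)).Local v)).1.val.val : Matrix (Fin 2) (Fin 2) (LocalRing L v)) * P.val) 1 1))⁻¹ : ℂ) *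
          ((Real.sqrt (∏ w' : PlacesOver L v, ‖(((P⁻¹).val * ((t : ((cmDatum L 2 (Matrix.of fun i j : Fin 2 => if i.val + j.val + 1 = 2 then (1 : L) else 0)).Local v × (cmDatum L 1 (Matrix.of fun i j : Fin 1 => if i.val + j.val + 1 = 1 then (1 : L) else 0)).Local v)).1.val.val : Matrix (Fin 2) (Fin 2) (LocalRing L v)) * P.val) 0 0 - ((P⁻¹).val * ((t : ((cmDatum L 2 (Matrix.of fun i j : Fin 2 => if i.val + j.val + 1 = 2 then (1 : L) else 0)).Local v × (cmDatum L 1 (Matrix.of fun i j : Fin 1 => if i.val + j.val + 1 = 1 then (1 : L) else 0)).Local v)).1.val.val : Matrix (Fin 2) (Fin 2) (LocalRing L v)) * P.val) 1 1) w'‖) : ℝ) : ℂ) * ((∫ y, (((cmLocalIntegralLevel L 2 (Matrix.of fun i j : Fin 2 => if i.val + j.val + 1 = 2 then (1 : L) else 0) v).prod (cmLocalIntegralLevel L 1 (Matrix.of fun i j : Fin 1 => if i.val + j.val + 1 = 1 then (1 : L) else 0) v) : Subgroup ((cmDatum L 2 (Matrix.of fun i j : Fin 2 => if i.val + j.val +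 1 = 2 then (1 : L) else 0)).Local v × (cmDatum L 1 (Matrix.of fun i j : Fin 1 => if i.val + j.val + 1 = 1 then (1 : L) else 0)).Local v)) : Set ((cmDatum L 2 (Matrix.of fun i j : Fin 2 => if i.val + j.val + 1 = 2 then (1 : L) else 0)).Local v × (cmDatum L 1 (Matrix.of fun i j : Fin 1 => if i.val + j.val + 1 = 1 then (1 : L) else 0)).Local v)).indicator (fun _ => (1 : ℂ)) (y * (t : ((cmDatum L 2 (Matrix.of fun i j : Fin 2 => if i.val + j.val + 1 = 2 then (1 : L) else 0)).Local v × (cmDatum L 1 (Matrix.of fun i j : Fin 1 => if i.val + j.val + 1 = 1 then (1 : L) else 0)).Local v)) * y⁻¹) ∂ν) - ∫ y, (((cmLocalIntegralLevel L 2 (Matrix.of fun i j : Fin 2 => if i.val + j.val + 1 = 2 then (1 : L) else 0) v).prod (cmLocalIntegralLevel L 1 (Matrix.of fun i j : Fin 1 => if i.val + j.val + 1 = 1 then (1 : L) else 0) v) : Subgroup ((cmDatum L 2 (Matrix.of fun i j : Fin 2 => if i.val + j.val + 1 = 2 then (1 : L) else 0)).Local v × (cmDatum L 1 (Matrix.of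 fun i j : Fin 1 => if i.val + j.val + 1 = 1 then (1 : L) else 0)).Local v)) : Set ((cmDatum L 2 (Matrix.of fun i j : Fin 2 => if i.val + j.val + 1 = 2 then (1 : L) else 0)).Local v × (cmDatum L 1 (Matrix.of fun i j : Fin 1 => if i.val + j.val + 1 = 1 then (1 : L) else 0)).Local v)).indicator (fun _ => (1 : ℂ)) (y * t' * y⁻¹) ∂ν) = 0 := by
  obtain ⟨r, hru, e, -, -, -, -, -, hest, hK, hν⟩ := exists_unitSimilitudePartner_of_ramified L v w hw he t₀ P d ht₀ hP hd1
  have hfix : ((((cmLocalIntegralLevel L 2 (Matrix.of fun i j : Fin 2 => if i.val + j.val + 1 = 2 then (1 : L) else 0) v).prod (cmLocalIntegralLevel L 1 (Matrix.of fun i j : Fin 1 => if i.val + j.val + 1 = 1 then (1 : L) else 0) v) : Subgroup ((cmDatum L 2 (Matrix.of fun i j : Fin 2 => if i.val + j.val + 1 = 2 then (1 : L) else 0)).Local v × (cmDatum L 1 (Matrix.of fun i j : Fin 1 => if i.val + j.val + 1 = 1 then (1 : L) else 0)).Local v)) : Set ((cmDatum L 2 (Matrix.of fun i j : Fin 2 =>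 if i.val + j.val + 1 = 2 then (1 : L) else 0)).Local v × (cmDatum L 1 (Matrix.of fun i j : Fin 1 => if i.val + j.val + 1 = 1 then (1 : L) else 0)).Local v)).indicator (fun _ => (1 : ℂ))) ∘ e = (((cmLocalIntegralLevel L 2 (Matrix.of fun i j : Fin 2 => if i.val + j.val + 1 = 2 then (1 : L) else 0) v).prod (cmLocalIntegralLevel L 1 (Matrix.of fun i j : Fin 1 => if i.val + j.val + 1 = 1 then (1 : L) else 0) v) : Subgroup ((cmDatum L 2 (Matrix.of fun i j : Fin 2 => if i.val + j.val + 1 = 2 then (1 : L) else 0)).Local v × (cmDatum L 1 (Matrix.of fun i j : Fin 1 => if i.val + j.val + 1 = 1 then (1 : L) else 0)).Local v)) : Set ((cmDatum L 2 (Matrix.of fun i j : Fin 2 => if i.val + j.val + 1 = 2 then (1 : L) else 0)).Local v × (cmDatum L 1 (Matrix.of fun i j : Fin 1 => if i.val + j.val + 1 = 1 then (1 : L) else 0)).Local v)).indicator (fun _ => (1 : ℂ)) := by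
    funext a
    simp only [Function.comp_apply]
    by_cases ha : a ∈ ((cmLocalIntegralLevel L 2 (Matrix.of fun i j : Fin 2 => if i.val + j.val + 1 = 2 then (1 : L) else 0) v).prod (cmLocalIntegralLevel L 1 (Matrix.of fun i j : Fin 1 => if i.val + j.val + 1 = 1 then (1 : L) else 0) v) : Subgroup ((cmDatum L 2 (Matrix.of fun i j : Fin 2 => if i.val + j.val + 1 = 2 then (1 : L) else 0)).Local v × (cmDatum L 1 (Matrix.of fun i j : Fin 1 => if i.val + j.val + 1 = 1 then (1 : L) else 0)).Local v))
    · rw [Set.indicator_of_mem (show e a ∈ (((cmLocalIntegralLevel L 2 (Matrix.of fun i j : Fin 2 => if i.val + j.val + 1 = 2 then (1 : L) else 0) v).prod (cmLocalIntegralLevel L 1 (Matrix.of fun i j : Fin 1 => if i.val + j.val + 1 = 1 then (1 : L) else 0) v) : Subgroup ((cmDatum L 2 (Matrix.of fun i j : Fin 2 => if i.val + j.val + 1 = 2 then (1 : L) else 0)).Local v × (cmDatum L 1 (Matrix.of fun i j : Fin 1 => if i.val + j.val + 1 = 1 then (1 : L) else 0)).Local v)) : Set ((cmDatum L 2 (Matrix.of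 fun i j : Fin 2 => if i.val + j.val + 1 = 2 then (1 : L) else 0)).Local v × (cmDatum L 1 (Matrix.of fun i j : Fin 1 => if i.val + j.val + 1 = 1 then (1 : L) else 0)).Local v)) from (hK a).2 ha), Set.indicator_of_mem (show a ∈ (((cmLocalIntegralLevel L 2 (Matrix.of fun i j : Fin 2 => if i.val + j.val + 1 = 2 then (1 : L) else 0) v).prod (cmLocalIntegralLevel L 1 (Matrix.of fun i j : Fin 1 => if i.val + j.val + 1 = 1 then (1 : L) else 0) v) : Subgroup ((cmDatum L 2 (Matrix.of fun i j : Fin 2 => if i.val + j.val + 1 = 2 then (1 : L) else 0)).Local v × (cmDatum L 1 (Matrix.of fun i j : Fin 1 => if i.val + j.val + 1 = 1 then (1 : L) else 0)).Local v)) : Set ((cmDatum L 2 (Matrix.of fun i j : Fin 2 => if i.val + j.val + 1 = 2 then (1 : L) else 0)).Local v × (cmDatum L 1 (Matrix.of fun i j : Fin 1 => if i.val + j.val + 1 = 1 then (1 : L) else 0)).Local v)) from ha)]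
    · rw [Set.indicator_of_notMem (show e a ∉ (((cmLocalIntegralLevel L 2 (Matrix.of fun i j : Fin 2 => if i.val + j.val + 1 = 2 then (1 : L) else 0) v).prod (cmLocalIntegralLevel L 1 (Matrix.of fun i j : Fin 1 => if i.val + j.val + 1 = 1 then (1 : L) else 0) v) : Subgroup ((cmDatum L 2 (Matrix.of fun i j : Fin 2 => if i.val + j.val + 1 = 2 then (1 : L) else 0)).Local v × (cmDatum L 1 (Matrix.of fun i j : Fin 1 => if i.val + j.val + 1 = 1 then (1 : L) else 0)).Local v)) : Set ((cmDatum L 2 (Matrix.of fun i j : Fin 2 => if i.val + j.val + 1 = 2 then (1 : L) else 0)).Local v × (cmDatum L 1 (Matrix.of fun i j : Fin 1 => if i.val + j.val + 1 = 1 then (1 : L) else 0)).Local v)) from fun h => ha ((hK a).1 h)), Set.indicator_of_notMem (show a ∉ (((cmLocalIntegralLevel L 2 (Matrix.of fun i j : Fin 2 => if i.val + j.val + 1 = 2 then (1 : L) else 0) v).prod (cmLocalIntegralLevel L 1 (Matrix.of fun i j : Fin 1 => if i.val + j.val + 1 = 1 then (1 : L) else 0) v) : Subgroup ((cmDatum L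 2 (Matrix.of fun i j : Fin 2 => if i.val + j.val + 1 = 2 then (1 : L) else 0)).Local v × (cmDatum L 1 (Matrix.of fun i j : Fin 1 => if i.val + j.val + 1 = 1 then (1 : L) else 0)).Local v)) : Set ((cmDatum L 2 (Matrix.of fun i j : Fin 2 => if i.val + j.val + 1 = 2 then (1 : L) else 0)).Local v × (cmDatum L 1 (Matrix.of fun i j : Fin 1 => if i.val + j.val + 1 = 1 then (1 : L) else 0)).Local v)) from ha)]
  exact rankOneDelta_mul_sub_integral_eq_zero_of_comp_eq L v w hw μ ν e (hν ν) _ hfix t₀ P d ht₀ hP hd1 t ht (hest t ht) t' hst hnc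

/-- **… in the `∃ fC` shape of `hcore_ram` (★ p843417's binder body) at `f = 𝟙_{K_H}`, with `fC = 0`** (locally constant): the ramified core statement for the unit, closed.
[cite: LabesseLanglands1979, §2 pp. 9–10] [cite: Rogawski1990, §4.9 Lemma 4.9.3 (4.9.2) p. 56] -/
theorem exists_core_indicator_of_ramified (w : PlacesOver L v) (hw : IsCMField.complexConj L • w.1 = w.1)
    (he : v.asIdeal.ramificationIdx' w.1.asIdeal ≠ 1) (μ : HeckeCharacter L)
    [MeasurableSpace ((cmDatum L 2 (Matrix.of fun i j : Fin 2 => if i.val + j.val + 1 = 2 then (1 : L) else 0)).Local v × (cmDatum L 1 (Matrix.of fun i j : Fin 1 => if i.val + j.val + 1 = 1 then (1 : L) else 0)).Local v)] [BorelSpace ((cmDatum L 2 (Matrix.of fun i j : Fin 2 => if i.val + j.val + 1 = 2 then (1 : L) else 0)).Local v × (cmDatum L 1 (Matrix.of fun i j : Fin 1 => if i.val + j.val + 1 = 1 then (1 : L) else 0)).Local v)] (ν : Measure ((cmDatum L 2 (Matrix.of fun i j : Fin 2 => if i.val + j.val + 1 = 2 then (1 : L) else 0)).Local v × (cmDatum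 L 1 (Matrix.of fun i j : Fin 1 => if i.val + j.val + 1 = 1 then (1 : L) else 0)).Local v)) [ν.IsHaarMeasure] [ν.IsMulRightInvariant]
    (t₀ : ((cmDatum L 2 (Matrix.of fun i j : Fin 2 => if i.val + j.val + 1 = 2 then (1 : L) else 0)).Local v × (cmDatum L 1 (Matrix.of fun i j : Fin 1 => if i.val + j.val + 1 = 1 then (1 : L) else 0)).Local v)) (P : GL (Fin 2) (LocalRing L v)) (d : Fin 2 → (LocalRing L v)) (ht₀ : IsRegularElt (t₀.1.val : GL (Fin 2) (LocalRing L v)))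
    (hP : (t₀.1.val.val : Matrix (Fin 2) (Fin 2) (LocalRing L v)) * P.val = P.val * Matrix.diagonal d) (hd1 : ∀ i, conjLocal L (IsCMField.complexConj L) v (d i) * d i = 1) :
    ∃ fC : ↥(Subgroup.centralizer ({t₀} : Set ((cmDatum L 2 (Matrix.of fun i j : Fin 2 => if i.val + j.val + 1 = 2 then (1 : L) else 0)).Local v × (cmDatum L 1 (Matrix.of fun i j : Fin 1 => if i.val + j.val + 1 = 1 then (1 : L) else 0)).Local v))) → ℂ, IsLocallyConstant fC ∧
      ∀ t : ↥(Subgroup.centralizer ({t₀} : Set ((cmDatum L 2 (Matrix.of fun i j : Fin 2 => if i.val + j.val + 1 = 2 then (1 : L) else 0)).Local v × (cmDatum L 1 (Matrix.of fun i j : Fin 1 => if i.val + j.val + 1 = 1 then (1 : L) else 0)).Local v))), IsRegularElt ((t : ((cmDatum L 2 (Matrix.of fun i j : Fin 2 => if i.val + j.val + 1 = 2 then (1 : L) else 0)).Local v × (cmDatum L 1 (Matrix.of fun i j : Fin 1 => if i.val + j.val + 1 = 1 then (1 : L) else 0)).Local v)).1.val : GL (Fin 2) (LocalRing L v)) → ∀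 t' : ((cmDatum L 2 (Matrix.of fun i j : Fin 2 => if i.val + j.val + 1 = 2 then (1 : L) else 0)).Local v × (cmDatum L 1 (Matrix.of fun i j : Fin 1 => if i.val + j.val + 1 = 1 then (1 : L) else 0)).Local v),
        IsLocalStablyConjH L v (t : ((cmDatum L 2 (Matrix.of fun i j : Fin 2 => if i.val + j.val + 1 = 2 then (1 : L) else 0)).Local v × (cmDatum L 1 (Matrix.of fun i j : Fin 1 => if i.val + j.val + 1 = 1 then (1 : L) else 0)).Local v)) t' → ¬ IsConj (t : ((cmDatum L 2 (Matrix.of fun i j : Fin 2 => if i.val + j.val + 1 = 2 then (1 : L) else 0)).Local v × (cmDatum L 1 (Matrix.of fun i j : Fin 1 => if i.val + j.val + 1 = 1 then (1 : L) else 0)).Local v)) t' →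
        ((finHeckeValue L v μ (((P⁻¹).val * ((t : ((cmDatum L 2 (Matrix.of fun i j : Fin 2 => if i.val + j.val + 1 = 2 then (1 : L) else 0)).Local v × (cmDatum L 1 (Matrix.of fun i j : Fin 1 => if i.val + j.val + 1 = 1 then (1 : L) else 0)).Local v)).1.val.val : Matrix (Fin 2) (Fin 2) (LocalRing L v)) * P.val) 0 0 - ((P⁻¹).val * ((t : ((cmDatum L 2 (Matrix.of fun i j : Fin 2 => if i.val + j.val + 1 = 2 then (1 : L) else 0)).Local v × (cmDatum L 1 (Matrix.of fun i j : Fin 1 => if i.val + j.val + 1 = 1 then (1 : L) else 0)).Local v)).1.val.val : Matrix (Fin 2) (Fin 2) (LocalRing L v)) * P.val) 1 1))⁻¹ : ℂ) *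
          ((Real.sqrt (∏ w' : PlacesOver L v, ‖(((P⁻¹).val * ((t : ((cmDatum L 2 (Matrix.of fun i j : Fin 2 => if i.val + j.val + 1 = 2 then (1 : L) else 0)).Local v × (cmDatum L 1 (Matrix.of fun i j : Fin 1 => if i.val + j.val + 1 = 1 then (1 : L) else 0)).Local v)).1.val.val : Matrix (Fin 2) (Fin 2) (LocalRing L v)) * P.val) 0 0 - ((P⁻¹).val * ((t : ((cmDatum L 2 (Matrix.of fun i j : Fin 2 => if i.val + j.val + 1 = 2 then (1 : L) else 0)).Local v × (cmDatum L 1 (Matrix.of fun i j : Fin 1 => if i.val + j.val + 1 = 1 then (1 : L) else 0)).Local v)).1.val.val : Matrix (Fin 2) (Fin 2) (LocalRing L v)) * P.val) 1 1) w'‖) : ℝ) : ℂ) * ((∫ y, (((cmLocalIntegralLevel L 2 (Matrix.of fun i j : Fin 2 => if i.val + j.val + 1 = 2 then (1 : L) else 0) v).prod (cmLocalIntegralLevel L 1 (Matrix.of fun i j : Fin 1 => if i.val + j.val + 1 = 1 then (1 : L) else 0) v) : Subgroup ((cmDatum L 2 (Matrix.of fun i j : Fin 2 => if i.val + j.val +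 1 = 2 then (1 : L) else 0)).Local v × (cmDatum L 1 (Matrix.of fun i j : Fin 1 => if i.val + j.val + 1 = 1 then (1 : L) else 0)).Local v)) : Set ((cmDatum L 2 (Matrix.of fun i j : Fin 2 => if i.val + j.val + 1 = 2 then (1 : L) else 0)).Local v × (cmDatum L 1 (Matrix.of fun i j : Fin 1 => if i.val + j.val + 1 = 1 then (1 : L) else 0)).Local v)).indicator (fun _ => (1 : ℂ)) (y * (t : ((cmDatum L 2 (Matrix.of fun i j : Fin 2 => if i.val + j.val + 1 = 2 then (1 : L) else 0)).Local v × (cmDatum L 1 (Matrix.of fun i j : Fin 1 => if i.val + j.val + 1 = 1 then (1 : L) else 0)).Local v)) * y⁻¹) ∂ν) - ∫ y, (((cmLocalIntegralLevel L 2 (Matrix.of fun i j : Fin 2 => if i.val + j.val + 1 = 2 then (1 : L) else 0) v).prod (cmLocalIntegralLevel L 1 (Matrix.of fun i j : Fin 1 => if i.val + j.val + 1 = 1 then (1 : L) else 0) v) : Subgroup ((cmDatum L 2 (Matrix.of fun i j : Fin 2 => if i.val + j.val + 1 = 2 then (1 : L) else 0)).Local v × (cmDatum L 1 (Matrix.of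 fun i j : Fin 1 => if i.val + j.val + 1 = 1 then (1 : L) else 0)).Local v)) : Set ((cmDatum L 2 (Matrix.of fun i j : Fin 2 => if i.val + j.val + 1 = 2 then (1 : L) else 0)).Local v × (cmDatum L 1 (Matrix.of fun i j : Fin 1 => if i.val + j.val + 1 = 1 then (1 : L) else 0)).Local v)).indicator (fun _ => (1 : ℂ)) (y * t' * y⁻¹) ∂ν) = fC t :=
  ⟨fun _ => 0, IsLocallyConstant.const 0, fun t ht t' hst hnc =>
    rankOneDelta_mul_sub_integral_indicator_eq_zero_of_ramified L v w hw he μ ν t₀ P d ht₀ hP hd1 t ht t' hst hnc⟩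

end UnitRow

end Literature.NumberTheory.Rogawski1990

end
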